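import Literature.AlgebraicGeometry.Resolution.RisoTriviality
import Literature.AlgebraicGeometry.Hironaka2017.WQRisoArcs
import HarnessLib

/-!
# Barrier «RisoBlindAlongInseparableOrbit» — kernel upgrade: `rtd_P(X₂) = 0` on the W-Q fourfold (characteristic 2)

Companion of `Literature/Barriers/ResolutionOfSingularities/RisoBlindAlongInseparableOrbit.lean` (barrier #4 of the
LADDER-RESOLUTION cell `res-hironaka`, D-0021 / D-0089; headline `Monreal2026_risoBlindAlongInseparableOrbit`). That file
certifies the MECHANISM (RV-blindness of a `p`-power orbit coordinate) and the SPECIMEN inputs, and records the rtd-values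
`rtd_0(X₂) = rtd_P(X₂) = 0` as the cell's HAND computation (report `KILL-TEST-K3.2prime.md` §9, lemmas (L1)–(L3), seat
res-L1-k32 g3; «second reader wanted»; scope-caveat (b): «risometries, arc balls, `rtsp`, `rtd` are NOT formalised at
Literature level»). THIS FILE closes that caveat for the point `P = (0,0,1,1,0)` (§§1–5) and — v2 addendum §6 —
for the ORIGIN `0`:

* the risometry notions are now typed (`Literature/AlgebraicGeometry/Resolution/RisoTriviality.lean`: Monreal's Def. 3.9 /
  Ex. 3.11 `Riso.RvEq`, Def. 3.15 `Riso.IsRisometry`, Def. 3.14 `Riso.IsTranslationInvariantOn`, Def. 3.17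
  `Riso.IsRisoTrivialOn` / `Riso.rtd`, for ONE set of arcs of `𝔸ⁿ` over an arbitrary valued ring);
* the specimen algebra is in `Literature/AlgebraicGeometry/Hironaka2017/WQRisoArcs.lean` (`WQRiso.G = fW − x²`, square-root
  arcs `WQRiso.arc r = (G(r), r²)`, the gradient table, the singular arcs near `P`, the `e_z`-dominance of the singular branch);
* and here the cell's lemmas are PROVED and assembled:
  `Monreal2026_risoBlindAlongInseparableOrbit_rtdP` — for EVERY perfect field `K` of characteristic `2`, EVERY non-trivial
  valuation `v : K → Γ₀` (any linearly ordered value group) and EVERY coefficient field `κ → K`: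
  `rtd v κ (X₂(K)) P 1 = 0` and no non-zero `κ`-subspace `W` makes `X₂(K) ∩ B_P` `W`-riso-trivial on `B_P`.
  v2 (§6): `Monreal2026_risoBlindAlongInseparableOrbit_rtdBoth` — the same at the origin `0` as well
  (`rtd v κ (X₂(K)) 0 1 = 0`), by a classification-free route (see the §6 header).

**Why this generality.** The source [Monreal2026] fixes an ADMISSIBLE extension `K/κ` (Def. 2.4: `K` algebraically closed,
spherically complete, `κ` the residue field with a section) and the cell's hand proof used `K = k((t^ℚ))`. The argument below
needs only: `K` a field of characteristic `2`, PERFECT (to write every arc as `(G(r), r²)` with `r = √(y,z,w,v)`), and `𝔪 ≠ 0`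
(one element `t` with `0 < v(t) < 1`, to have test levels). No Hahn series, no residue-field section, no algebraic closure.
Multiplicative valuation convention throughout (`v ≤ 1` integral, smaller = deeper; dictionary in `RisoTriviality.lean`).

## The proof (report §9.2–§9.4, re-derived; `A_P := X₂(K) ∩ B_P`, `B_P = ball v P 1` = arcs based at `P`)

* §2 **(L1) the transported property.** `𝒫(S,a)` := «for all sufficiently deep levels `v(s)` there is `b ∈ S` at valuative
  distance exactly `v(s)` from `a` with `b − a` `x`-dominant (`rv(b−a) = rv(c·e_x)`)». It is phrased through valuative
  distances and rv-classes of differences, so it is transported by risometries (`PropP.iff_map`, from Def. 3.15) and by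
  translations (`PropP.add_const`). [The report's `LV`-sets are replaced by rv-classes + coordinate dominance
  (`Riso.IsDominant`), which avoids leading-coefficient vectors and the uniformiser section `t^μ`.]
* §3 **(L2, first half) `𝒫` characterises the non-singular arcs.** Write `b − a = (∂G(r)·ε + T, ε²)` for `a = arc r`,
  `b = arc(r+ε)`, with `v(T) ≤ ‖ε‖²` (second-order Taylor bound for integer polynomials, `taylor_val_bound`, structural
  induction). If `∂G(r) = 0` the `x`-coordinate never leads (`not_propP_of_singular`); if `∂_{i₀}G(r)` has the maximal
  valuation `λ = ‖∂G(r)‖ > 0`, displacing by `(s/∂_{i₀}G(r))·e_{i₀}` realises every level `v(s) < λ²` `x`-dominantly inside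
  `A_P` (`propP_of_nonsingular`).
* §4 **(L3) cancellation.** If `w` (`‖w‖ = 1`) is not `x`-dominant, `a = arc r` is non-singular and `b ∈ A_P` has
  `rv(b − a) = rv(σ²·w)` with `v(σ) < λ`, then `‖ε‖ = v(σ)`, the leading terms of `∂G(r)·ε` cancel, and `ρ = ε/σ` is integral
  with `ρ² ≡ (w_y,w_z,w_w,w_v) (mod 𝔪)` and `v(∂G(r)·ρ) < λ` (`cancel_of_rvEq`) — the report's
  «`W̄ ⊆ k·e_x ⊕ Frob(ker ℓ̄_a)`», with levels restricted to squares so that no square roots are taken.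
* §5 **assembly** (`core`). Given a risometry `φ : A_P → C` with `C + 𝔪·w ⊆ C`: (i) `P = arc(0,1,1,0)` is singular; the
  translate `φ(P) + t·w` pulls back to an arc `b₁ ∈ A_P` which is again singular (L1/L2) with `rv(b₁ − P) = rv(t·w)`; by
  `WQRiso.singular_near_P` both are on the branch `{y = v = 0, w⁵ = z⁶}` and by `WQRiso.zdom_of_singularType` their
  difference is `e_z`-dominant — so `w` is `e_z`-dominant: `v(w_z) = 1`, the other coordinates in `𝔪`. (ii) L3 at the three
  test arcs `WQRiso.testArcW/Y/V` (gradients `(t+t⁴+t⁵,0,0,0)`, `(t¹⁰,0,t,0)`, `(t⁴,t²,t²+t⁶,0)`, levels `σ = t³`) gives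
  `w_y ∈ 𝔪`, `w_w ∈ 𝔪`, `w_z + w_w ∈ 𝔪`, hence `w_z ∈ 𝔪` — contradiction. Normalising a non-zero vector of `W` to a
  primitive `w` gives `wq_not_isRisoTrivialOn_P`; `Riso.rtd_eq_zero_of` gives `wq_rtd_P_eq_zero`; `wq_P_mem` records that the
  ball meets `X₂` (so `0` is the genuine maximum of Def. 3.17, attained at `V = 0`).

## Second reading of the cell's report (res-L1-k32 WANTED 2026-08-27T03:05:01Z, item (i))

READ-AGREE on §9.2 (L1)–(L3) and §9.4 (rtd_P = 0) with two precisions that the kernel forced: (a) L3 needs the level of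
`b − a` to be below `λ²` (additively: `μ > 2λ_a`, as the report states) AND uses that `b − a` is not `x`-dominant to get
`‖ε‖² = ‖b − a‖`; (b) in §9.4 (i) «near `P`, `Sing(X₂)` is the single branch `Γ₂`» is here a two-line valuation argument
(`WQRiso.singular_near_P`: `∂_wG = 0 ⇒ v(y) = v(v)²`; `∂_zG = 0 ⇒ v(v)² = v(y)·v(β)` with `β ∈ 𝔪` because `w⁵ + z⁶ ≡ 2 = 0`),
valid for arcs over any valued field of characteristic `2`, not only over `k((t^ℚ))`. §9.3 (`rtd_0 = 0`): READ-AGREE on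
the conclusion, re-proved in §6 WITHOUT the report's classification of the eight singular branches through `0` (L2 at the
origin arc + the rv-invariant «the `v`-coordinate attains the size» + L3 at three arcs based at `0`). NOT re-read here: §3
(W1, characteristic `3`).

## Honest framing

Everything here is a theorem about Monreal's DEFINITIONS 3.14/3.15/3.17 typed for one arc set in `𝔸ⁿ`, applied to the
cell's own specimen `fW`; no theorem of [Monreal2026] is used or asserted; nothing bears on the characteristic-0 theory, on
Question 1.6 in general, on resolution of singularities in characteristic `p`, or on H. Hironaka's 2017 manuscript (under
adjudication in cell res-hironaka, D-0012 — not cited by any declaration here). AI formalisation; the barrier entry's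
`status:` line may now read «rtd_P = 0 kernel-certified (this file); rtd_0 = 0 hand (report §9.3)».
-/

noncomputable section

namespace Literature.Barriers.ResolutionOfSingularities

namespace RisoBlind

open MvPolynomial Finset
open Literature.AlgebraicGeometry.Resolution Literature.AlgebraicGeometry.Resolution.Riso
open Literature.AlgebraicGeometry.Hironaka2017 Literature.AlgebraicGeometry.Hironaka2017.WQWitness
open Literature.AlgebraicGeometry.Hironaka2017.WQRiso

variable {K : Type*} [Field K] {Γ₀ : Type*} [LinearOrderedCommGroupWithZero Γ₀] (v : Valuation K Γ₀)

/-! ## §0 Valuation helpers -/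

/-- `v(n) ≤ 1`. [folklore] -/
private theorem val_natCast_le_one' (n : ℕ) : v (n : K) ≤ 1 := by
  induction n with
  | zero => simp
  | succ n ih =>
    rw [Nat.cast_succ]
    exact (v.map_add _ _).trans (max_le ih (by rw [v.map_one]))

/-- `v(z) ≤ 1` for integers. [folklore] -/
private theorem val_intCast_le_one' (z : ℤ) : v (z : K) ≤ 1 := by
  obtain ⟨n, rfl | rfl⟩ := Int.eq_nat_or_neg z
  · simpa using val_natCast_le_one' v n
  · simp only [Int.cast_neg, Int.cast_natCast, Valuation.map_neg]
    exact val_natCast_le_one' v n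

/-- Squaring is injective on `Γ₀`. [folklore] -/
private theorem eq_of_sq_eq_sq {a b : Γ₀} (h : a ^ 2 = b ^ 2) : a = b := by
  rcases lt_trichotomy a b with hab | hab | hab
  · exact absurd h (pow_lt_pow_left₀ hab zero_le two_ne_zero).ne
  · exact hab
  · exact absurd h (pow_lt_pow_left₀ hab zero_le two_ne_zero).ne'

/-- `vnorm` of coordinatewise squares is the square of `vnorm`. [folklore] -/
private theorem vnorm_sq {n : ℕ} [NeZero n] (ε : Fin n → K) : vnorm v (fun i => ε i ^ 2) = vnorm v ε ^ 2 := by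
  refine le_antisymm ((vnorm_le_iff v).2 fun i => ?_) ?_
  · rw [map_pow]; exact pow_le_pow_left₀ zero_le (le_vnorm v ε i) 2
  · obtain ⟨i, hi⟩ := exists_vnorm_eq v ε
    rw [hi, ← map_pow]
    exact le_vnorm v (fun i => ε i ^ 2) i

/-- **Second-order Taylor bound (valuation form)** for an integer polynomial in finitely many variables: for integral `r`
and `v(εᵢ) ≤ m ≤ 1`, `v(p(r+ε) − p(r) − Σᵢ ∂ᵢp(r)εᵢ) ≤ m²`, `v(p(r)) ≤ 1`, `v(Σᵢ ∂ᵢp(r)εᵢ) ≤ m`. Structural induction on `p`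
(`p·Xᵢ`: remainder `T·rᵢ + (T + D)·εᵢ`). [folklore] -/
private theorem taylor_val_bound {σ : Type*} [Fintype σ] [DecidableEq σ] (p : MvPolynomial σ ℤ) {r ε : σ → K} {m : Γ₀}
    (hr : ∀ i, v (r i) ≤ 1) (hε : ∀ i, v (ε i) ≤ m) (hm : m ≤ 1) :
    v (aeval (r + ε) p - aeval r p - ∑ i, aeval r (pderiv i p) * ε i) ≤ m ^ 2 ∧
      v (aeval r p) ≤ 1 ∧ v (∑ i, aeval r (pderiv i p) * ε i) ≤ m := by
  induction p using MvPolynomial.induction_on with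
  | C a =>
    have h1 : aeval (r + ε) (C a : MvPolynomial σ ℤ) = (a : K) := by simp
    have h2 : aeval r (C a : MvPolynomial σ ℤ) = (a : K) := by simp
    have h3 : ∀ j, pderiv j (C a : MvPolynomial σ ℤ) = 0 := fun j => pderiv_C
    simp only [h1, h2, h3, map_zero, zero_mul, Finset.sum_const_zero, sub_self]
    exact ⟨zero_le, val_intCast_le_one' v a, zero_le⟩
  | add p q hp hq =>
    obtain ⟨hp1, hp2, hp3⟩ := hp
    obtain ⟨hq1, hq2, hq3⟩ := hq
    refine ⟨?_, ?_, ?_⟩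
    · have : aeval (r + ε) (p + q) - aeval r (p + q) - ∑ i, aeval r (pderiv i (p + q)) * ε i =
          (aeval (r + ε) p - aeval r p - ∑ i, aeval r (pderiv i p) * ε i) +
          (aeval (r + ε) q - aeval r q - ∑ i, aeval r (pderiv i q) * ε i) := by
        simp only [map_add, add_mul, sum_add_distrib]; ring
      rw [this]
      exact (v.map_add _ _).trans (max_le hp1 hq1)
    · rw [map_add]; exact (v.map_add _ _).trans (max_le hp2 hq2)
    · have : ∑ i, aeval r (pderiv i (p + q)) * ε i =
          ∑ i, aeval r (pderiv i p) * ε i + ∑ i, aeval r (pderiv i q) * ε i := by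
        simp only [map_add, add_mul, sum_add_distrib]
      rw [this]
      exact (v.map_add _ _).trans (max_le hp3 hq3)
  | mul_X p i hp =>
    obtain ⟨hp1, hp2, hp3⟩ := hp
    set T := aeval (r + ε) p - aeval r p - ∑ j, aeval r (pderiv j p) * ε j with hT
    set D := ∑ j, aeval r (pderiv j p) * ε j with hD
    set Q := aeval r p with hQ
    have hQ' : aeval (r + ε) p = T + Q + D := by rw [hT]; ring
    have hDX : ∑ j, aeval r (pderiv j (p * X i)) * ε j = D * r i + Q * ε i := by
      have key : ∀ j, aeval r (pderiv j (p * X i)) * ε j =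
          aeval r (pderiv j p) * ε j * r i + (if j = i then Q * ε i else 0) := by
        intro j
        rw [pderiv_mul, pderiv_X, map_add, map_mul, map_mul, aeval_X]
        by_cases hji : j = i
        · subst hji
          rw [Pi.single_eq_same, map_one, if_pos rfl, hQ]; ring
        · rw [Pi.single_eq_of_ne (Ne.symm hji), map_zero, if_neg hji]; ring
      rw [Finset.sum_congr rfl fun j _ => key j, sum_add_distrib, Finset.sum_ite_eq' univ i,
        if_pos (mem_univ i), ← Finset.sum_mul, hD]
    have hm2 : m ^ 2 ≤ m := by
      calc m ^ 2 = m * m := sq m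
        _ ≤ m * 1 := mul_le_mul' le_rfl hm
        _ = m := mul_one m
    refine ⟨?_, ?_, ?_⟩
    · have : aeval (r + ε) (p * X i) - aeval r (p * X i) - ∑ j, aeval r (pderiv j (p * X i)) * ε j =
          T * r i + (T + D) * ε i := by
        rw [hDX, map_mul, map_mul, aeval_X, aeval_X, hQ', Pi.add_apply]; ring
      rw [this]
      refine (v.map_add _ _).trans (max_le ?_ ?_)
      · rw [map_mul]; exact mul_le_mul' hp1 (hr i) |>.trans (by rw [mul_one])
      · rw [map_mul]
        calc v (T + D) * v (ε i) ≤ m * m :=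
              mul_le_mul' ((v.map_add _ _).trans (max_le (hp1.trans hm2) hp3)) (hε i)
          _ = m ^ 2 := (sq m).symm
    · rw [map_mul, aeval_X, map_mul]
      exact mul_le_mul' hp2 (hr i) |>.trans (by rw [mul_one])
    · rw [hDX]
      refine (v.map_add _ _).trans (max_le ?_ ?_)
      · rw [map_mul]; exact mul_le_mul' hp3 (hr i) |>.trans (by rw [mul_one])
      · rw [map_mul]; exact mul_le_mul' hp2 (hε i) |>.trans (by rw [one_mul])

/-! ## §1 Arcs based at `P`: the ball `B_P` in square-root coordinates -/

/-- `arc r` at the five coordinate indices. [folklore] -/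
private theorem arc_apply (r : Fin 4 → K) :
    arc r 0 = aeval r G ∧ arc r 1 = r 0 ^ 2 ∧ arc r 2 = r 1 ^ 2 ∧ arc r 3 = r 2 ^ 2 ∧ arc r 4 = r 3 ^ 2 :=
  ⟨rfl, rfl, rfl, rfl, rfl⟩

/-- `P = (0,0,1,1,0)` at the five coordinate indices. [folklore] -/
private theorem P_apply :
    (![0, 0, 1, 1, 0] : Fin 5 → K) 0 = 0 ∧ (![0, 0, 1, 1, 0] : Fin 5 → K) 1 = 0 ∧ (![0, 0, 1, 1, 0] : Fin 5 → K) 2 = 1 ∧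
      (![0, 0, 1, 1, 0] : Fin 5 → K) 3 = 1 ∧ (![0, 0, 1, 1, 0] : Fin 5 → K) 4 = 0 :=
  ⟨rfl, rfl, rfl, rfl, rfl⟩

/-- `a² < 1 ↔ a < 1` in `Γ₀`. [folklore] -/
private theorem sq_lt_one_iff' (a : Γ₀) : a ^ 2 < 1 ↔ a < 1 := by
  constructor
  · intro h
    by_contra hx
    exact absurd h (not_lt.2 (one_le_pow₀ (not_lt.1 hx)))
  · intro h; exact pow_lt_one₀ zero_le h two_ne_zero

section CharTwo

variable [CharP K 2]

/-- The coordinates of `arc r − P`, `P = (0,0,1,1,0)`: `(G(r), r₀², (r₁−1)², (r₂−1)², r₃²)`. [folklore] -/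
private theorem arc_sub_P (r : Fin 4 → K) :
    (arc r - (![0, 0, 1, 1, 0] : Fin 5 → K)) 0 = aeval r G ∧ (arc r - (![0, 0, 1, 1, 0] : Fin 5 → K)) 1 = r 0 ^ 2 ∧
      (arc r - (![0, 0, 1, 1, 0] : Fin 5 → K)) 2 = (r 1 - 1) ^ 2 ∧
      (arc r - (![0, 0, 1, 1, 0] : Fin 5 → K)) 3 = (r 2 - 1) ^ 2 ∧
      (arc r - (![0, 0, 1, 1, 0] : Fin 5 → K)) 4 = r 3 ^ 2 := by
  haveI : Fact (Nat.Prime 2) := ⟨Nat.prime_two⟩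
  obtain ⟨a0, a1, a2, a3, a4⟩ := arc_apply r
  obtain ⟨p0, p1, p2, p3, p4⟩ := P_apply (K := K)
  simp only [Pi.sub_apply, a0, a1, a2, a3, a4, p0, p1, p2, p3, p4, sub_zero]
  refine ⟨trivial, trivial, ?_, ?_, trivial⟩
  · rw [sub_pow_char, one_pow]
  · rw [sub_pow_char, one_pow]

/-- `arc r ∈ B_P` iff `G(r) ∈ 𝔪`, `r₀, r₃ ∈ 𝔪`, `r₁ ≡ r₂ ≡ 1 (mod 𝔪)`. [folklore] -/
private theorem arc_mem_ball_iff (r : Fin 4 → K) :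
    arc r ∈ ball v (![0, 0, 1, 1, 0] : Fin 5 → K) 1 ↔
      v (aeval r G) < 1 ∧ v (r 0) < 1 ∧ v (r 1 - 1) < 1 ∧ v (r 2 - 1) < 1 ∧ v (r 3) < 1 := by
  obtain ⟨c0, c1, c2, c3, c4⟩ := arc_sub_P r
  rw [mem_ball_iff, vnorm_lt_iff v zero_lt_one, Fin.forall_fin_succ, Fin.forall_fin_succ, Fin.forall_fin_succ,
    Fin.forall_fin_succ, Fin.forall_fin_succ]
  simp only [IsEmpty.forall_iff, and_true]
  rw [show (0 : Fin 4).succ = 1 from rfl, show (0 : Fin 3).succ.succ = 2 from rfl,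
    show (0 : Fin 2).succ.succ.succ = 3 from rfl, show (0 : Fin 1).succ.succ.succ.succ = 4 from rfl,
    c0, c1, c2, c3, c4, map_pow, map_pow, map_pow, map_pow, sq_lt_one_iff', sq_lt_one_iff', sq_lt_one_iff',
    sq_lt_one_iff']

/-- Square-root coordinates of an arc based at `P` are integral. [folklore] -/
private theorem integral_of_arc_mem_ball {r : Fin 4 → K} (h : arc r ∈ ball v (![0, 0, 1, 1, 0] : Fin 5 → K) 1) :
    ∀ i, v (r i) ≤ 1 := by
  obtain ⟨-, h0, h1, h2, h3⟩ := (arc_mem_ball_iff v r).1 h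
  have hone : ∀ x : K, v (x - 1) < 1 → v x ≤ 1 := fun x hx => by
    have : x = 1 + (x - 1) := by ring
    rw [this]; exact (v.map_one_add_of_lt hx).le
  intro i
  fin_cases i
  · exact h0.le
  · exact hone _ h1
  · exact hone _ h2
  · exact h3.le

end CharTwo

/-! ## §2 The property 𝒫: «arcs of `S` at every small level in the `x`-direction from `a`» -/

/-- `𝒫(S,a)`: there is a threshold `s₀ ≠ 0` such that at every level `v(s)`, `s ≠ 0`, `v(s) < v(s₀)`, the set `S` contains an
arc `b` at valuative distance exactly `v(s)` from `a` with `b − a` `x`-dominant (`rv(b − a) = rv((b−a)₀·e_x)`). It is phrased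
through valuative distances and rv-classes of differences only, hence transported by risometries and translations. [folklore] -/
private def PropP (S : Set (Fin 5 → K)) (a : Fin 5 → K) : Prop :=
  ∃ s₀ : K, s₀ ≠ 0 ∧ ∀ s : K, s ≠ 0 → v s < v s₀ → ∃ b ∈ S, vnorm v (b - a) = v s ∧ IsDominant v 0 (b - a)

/-- `𝒫` is monotone in the set. [folklore] -/
private theorem PropP.mono {S S' : Set (Fin 5 → K)} {a : Fin 5 → K} (h : PropP v S a) (hS : S ⊆ S') : PropP v S' a := by
  obtain ⟨s₀, hs₀, H⟩ := h
  refine ⟨s₀, hs₀, fun s hs hlt => ?_⟩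
  obtain ⟨b, hb, h1, h2⟩ := H s hs hlt
  exact ⟨b, hS hb, h1, h2⟩

/-- `𝒫` is transported by risometries (L1 of the cell's report: rv-classes and valuative distances of differences are
preserved, Def. 3.15 / Rem. 3.16). [folklore] -/
private theorem PropP.map {S S' : Set (Fin 5 → K)} {a : Fin 5 → K} {φ : (Fin 5 → K) → (Fin 5 → K)}
    (hφ : IsRisometry v S S' φ) (ha : a ∈ S) (h : PropP v S a) : PropP v S' (φ a) := by
  obtain ⟨s₀, hs₀, H⟩ := h
  refine ⟨s₀, hs₀, fun s hs hlt => ?_⟩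
  obtain ⟨b, hb, hvn, hdom⟩ := H s hs hlt
  refine ⟨φ b, hφ.bijOn.mapsTo hb, ?_, ?_⟩
  · rw [hφ.vnorm_sub_eq hb ha, hvn]
  · exact hdom.of_rvEq (hφ.rvEq hb ha).symm

/-- `𝒫` is invariant under risometries. [folklore] -/
private theorem PropP.iff_map {S S' : Set (Fin 5 → K)} {a : Fin 5 → K} {φ : (Fin 5 → K) → (Fin 5 → K)}
    (hφ : IsRisometry v S S' φ) (ha : a ∈ S) : PropP v S a ↔ PropP v S' (φ a) := by
  refine ⟨PropP.map v hφ ha, fun h => ?_⟩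
  have := PropP.map v hφ.symm (hφ.bijOn.mapsTo ha) h
  rwa [hφ.bijOn.invOn_invFunOn.1 ha] at this

/-- `𝒫` is transported by translations. [folklore] -/
private theorem PropP.add_const {S : Set (Fin 5 → K)} {a : Fin 5 → K} (t : Fin 5 → K) (h : PropP v S a) :
    PropP v ((· + t) '' S) (a + t) := by
  obtain ⟨s₀, hs₀, H⟩ := h
  refine ⟨s₀, hs₀, fun s hs hlt => ?_⟩
  obtain ⟨b, hb, hvn, hdom⟩ := H s hs hlt
  refine ⟨b + t, ⟨b, hb, rfl⟩, ?_, ?_⟩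
  · rw [add_sub_add_right_eq_sub, hvn]
  · rw [add_sub_add_right_eq_sub]; exact hdom


/-! ## §3 Singular versus non-singular arcs of `A_P = X₂(K) ∩ B_P` (the cell's L2, first half) -/

/-- The gradient of `G` at an integral point is integral: `‖∂G(r)‖ ≤ 1`. [folklore] -/
private theorem vnorm_grad_le_one {r : Fin 4 → K} (hr : ∀ i, v (r i) ≤ 1) :
    vnorm v (fun j => aeval r (pderiv j G)) ≤ 1 := by
  refine (vnorm_le_iff v).2 fun j => ?_
  have h := (taylor_val_bound v (pderiv j G) (ε := 0) (m := 1) hr (fun _ => by simp) le_rfl).2.1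
  exact h

section CharTwo

variable [CharP K 2]

/-- **Non-singular arcs satisfy `𝒫`** (report L2, first half): if some `∂ᵢG(r) ≠ 0`, let `λ = ‖∂G(r)‖ = v(∂_{i₀}G(r))` and
`s₀ = (∂_{i₀}G(r))²`; for `v(s) < λ²` the arc `b = arc(r + (s/∂_{i₀}G(r))·e_{i₀})` lies in `A_P`, at distance `v(s)` from `arc r`,
with `x`-dominant difference `(s + O(ν²), ε²)`, `ν = v(s)/λ`, `ν² < v(s)`. [folklore] -/
private theorem propP_of_nonsingular {r : Fin 4 → K} (hr : arc r ∈ ball v (![0, 0, 1, 1, 0] : Fin 5 → K) 1)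
    {i : Fin 4} (hi : aeval r (pderiv i G) ≠ 0) :
    PropP v ({a | eval a (fW : MvPolynomial (Fin 5) K) = 0} ∩ ball v ![0, 0, 1, 1, 0] 1) (arc r) := by
  haveI : Fact (Nat.Prime 2) := ⟨Nat.prime_two⟩
  set ℓ : Fin 4 → K := fun j => aeval r (pderiv j G) with hℓ
  obtain ⟨i₀, hi₀⟩ := exists_vnorm_eq v ℓ
  have hlam_pos : 0 < vnorm v ℓ := by
    have : 0 < v (ℓ i) := lt_of_le_of_ne zero_le ((Valuation.ne_zero_iff v).2 hi).symm
    exact lt_of_lt_of_le this (le_vnorm v ℓ i)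
  have hℓi₀ : ℓ i₀ ≠ 0 := (Valuation.ne_zero_iff v).1 (by rw [← hi₀]; exact hlam_pos.ne')
  have hrint := integral_of_arc_mem_ball v hr
  have hlam_le : vnorm v ℓ ≤ 1 := vnorm_grad_le_one v hrint
  obtain ⟨hG, h0, h1, h2, h3⟩ := (arc_mem_ball_iff v r).1 hr
  refine ⟨ℓ i₀ ^ 2, pow_ne_zero 2 hℓi₀, fun s hs hslt => ?_⟩
  rw [map_pow, ← hi₀] at hslt
  -- the displacement ε = (s/ℓ_{i₀}) e_{i₀}, of size ν = v(s)/λ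
  set ε : Fin 4 → K := Pi.single i₀ (s / ℓ i₀) with hε
  set ν : Γ₀ := v (s / ℓ i₀) with hν
  have hvs : 0 < v s := lt_of_le_of_ne zero_le ((Valuation.ne_zero_iff v).2 hs).symm
  have hνlam : ν * vnorm v ℓ = v s := by rw [hν, map_div₀, ← hi₀, div_mul_cancel₀ _ hlam_pos.ne']
  have hεv : ∀ j, v (ε j) ≤ ν := by
    intro j
    by_cases hj : j = i₀
    · subst hj; rw [hε, Pi.single_eq_same]
    · rw [hε, Pi.single_eq_of_ne hj, Valuation.map_zero]; exact zero_le
  have hν_pos : 0 < ν := by rw [hν, map_div₀, ← hi₀]; exact div_pos hvs hlam_pos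
  have hν_lt_lam : ν < vnorm v ℓ := by
    by_contra hle
    have : vnorm v ℓ * vnorm v ℓ ≤ ν * vnorm v ℓ := mul_le_mul' (not_lt.1 hle) le_rfl
    rw [hνlam, ← sq] at this
    exact absurd hslt (not_lt.2 this)
  have hν_le : ν ≤ 1 := (hν_lt_lam.le).trans hlam_le
  have hν2 : ν ^ 2 < v s := by
    calc ν ^ 2 = ν * ν := sq ν
      _ < ν * vnorm v ℓ := (mul_lt_mul_iff_of_pos_left hν_pos).2 hν_lt_lam
      _ = v s := hνlam
  have hν2_lt_one : ν ^ 2 < 1 := lt_of_lt_of_le hν2 ((le_vnorm v ℓ i₀ |> fun h => ?_))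
  swap
  · -- v s < λ² ≤ 1
    exact (hslt.trans_le (by simpa [sq] using mul_le_mul' hlam_le hlam_le)).le
  -- Taylor at r with displacement ε
  have hsum : ∑ j, aeval r (pderiv j G) * ε j = s := by
    rw [Finset.sum_eq_single i₀ (fun j _ hj => by rw [hε, Pi.single_eq_of_ne hj, mul_zero])
      (fun h => absurd (mem_univ i₀) h), hε, Pi.single_eq_same]
    exact mul_div_cancel₀ _ hℓi₀
  obtain ⟨hT, -, -⟩ := taylor_val_bound v G hrint hεv hν_le
  rw [hsum] at hT
  -- hT : v (G(r+ε) − G r − s) ≤ ν²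
  set b := arc (r + ε) with hb
  have hx : (b - arc r) 0 = s + (aeval (r + ε) G - aeval r G - s) := by
    rw [hb, arc_sub_arc_zero]; ring
  have hvx : v ((b - arc r) 0) = v s := by
    rw [hx]; exact v.map_add_eq_of_lt_left (hT.trans_lt hν2)
  have hq : ∀ j : Fin 4, v ((b - arc r) j.succ) ≤ ν ^ 2 := by
    intro j
    rw [hb, arc_sub_arc_succ, Pi.add_apply, add_sub_cancel_left, map_pow]
    exact pow_le_pow_left₀ zero_le (hεv j) 2
  have hdom : IsDominant v 0 (b - arc r) := by
    intro j hj
    obtain ⟨j', rfl⟩ := Fin.exists_succ_eq.2 hj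
    rw [hvx]
    exact (hq j').trans_lt hν2
  refine ⟨b, ⟨?_, ?_⟩, by rw [hdom.vnorm_eq, hvx], hdom⟩
  · exact eval_fW_arc (r + ε)
  · -- b ∈ ball P 1
    rw [hb, arc_mem_ball_iff v]
    have hεlt : ∀ j, v (ε j) < 1 := fun j => (hεv j).trans_lt (hν_lt_lam.trans_le hlam_le)
    refine ⟨?_, ?_, ?_, ?_, ?_⟩
    · have : aeval (r + ε) G = aeval r G + (s + (aeval (r + ε) G - aeval r G - s)) := by ring
      rw [this]
      refine lt_of_le_of_lt (v.map_add _ _) (max_lt hG (lt_of_le_of_lt (v.map_add _ _) (max_lt ?_ ?_)))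
      · exact hslt.trans_le (by simpa [sq] using mul_le_mul' hlam_le hlam_le)
      · exact hT.trans_lt hν2_lt_one
    · rw [Pi.add_apply]; exact lt_of_le_of_lt (v.map_add _ _) (max_lt h0 (hεlt 0))
    · rw [Pi.add_apply, show r 1 + ε 1 - 1 = (r 1 - 1) + ε 1 by ring]
      exact lt_of_le_of_lt (v.map_add _ _) (max_lt h1 (hεlt 1))
    · rw [Pi.add_apply, show r 2 + ε 2 - 1 = (r 2 - 1) + ε 2 by ring]
      exact lt_of_le_of_lt (v.map_add _ _) (max_lt h2 (hεlt 2))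
    · rw [Pi.add_apply]; exact lt_of_le_of_lt (v.map_add _ _) (max_lt h3 (hεlt 3))

/-- **Singular arcs violate `𝒫`** (report L2, first half): if `∂G(r) = 0` then for every other arc `b = arc r'` of `A_P`,
`b − arc r = (O(‖ε‖²), ε²)` with `ε = r' − r` — the `x`-coordinate never leads. (Needs a non-trivial valuation to have a
level below the threshold, and a PERFECT ground field to write `b = arc r'`.) [folklore] -/
private theorem not_propP_of_singular [PerfectRing K 2] (hK : ∃ t : K, 0 < v t ∧ v t < 1) {r : Fin 4 → K}
    (hr : arc r ∈ ball v (![0, 0, 1, 1, 0] : Fin 5 → K) 1) (hsing : ∀ i, aeval r (pderiv i G) = 0) :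
    ¬ PropP v ({a | eval a (fW : MvPolynomial (Fin 5) K) = 0} ∩ ball v ![0, 0, 1, 1, 0] 1) (arc r) := by
  rintro ⟨s₀, hs₀, H⟩
  obtain ⟨t, ht0, ht1⟩ := hK
  have ht : t ≠ 0 := (Valuation.ne_zero_iff v).1 ht0.ne'
  have hvs₀ : 0 < v s₀ := lt_of_le_of_ne zero_le ((Valuation.ne_zero_iff v).2 hs₀).symm
  obtain ⟨b, ⟨hbX, hbB⟩, hvn, hdom⟩ := H (s₀ * t) (mul_ne_zero hs₀ ht)
    (by rw [map_mul]; exact mul_lt_of_lt_one_right hvs₀ ht1)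
  obtain ⟨r', rfl⟩ := exists_arc_eq hbX
  have hrint := integral_of_arc_mem_ball v hr
  have hr'int := integral_of_arc_mem_ball v hbB
  set ε : Fin 4 → K := r' - r with hε
  have hr' : r' = r + ε := by rw [hε]; abel
  have hεv : ∀ j, v (ε j) ≤ vnorm v ε := le_vnorm v ε
  have hm1 : vnorm v ε ≤ 1 := (vnorm_le_iff v).2 fun j => by
    rw [hε, Pi.sub_apply]; exact (v.map_sub _ _).trans (max_le (hr'int j) (hrint j))
  obtain ⟨hT, -, -⟩ := taylor_val_bound v G hrint hεv hm1
  have hsum : ∑ j, aeval r (pderiv j G) * ε j = 0 := Finset.sum_eq_zero fun j _ => by rw [hsing j, zero_mul]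
  rw [hsum, sub_zero, ← hr'] at hT
  -- hT : v (G r' − G r) ≤ ‖ε‖²
  obtain ⟨j₀, hj₀⟩ := exists_vnorm_eq v ε
  have hq : v ((arc r' - arc r) j₀.succ) = vnorm v ε ^ 2 := by
    rw [arc_sub_arc_succ, map_pow, hj₀, hε, Pi.sub_apply]
  have hlt := hdom j₀.succ (Fin.succ_ne_zero j₀)
  rw [hq, arc_sub_arc_zero] at hlt
  exact absurd (hT.trans_lt hlt) (lt_irrefl _)

end CharTwo

/-! ## §4 The cancellation lemma at a non-singular arc (the cell's L3) -/

section CharTwo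

variable [CharP K 2]

/-- **L3′ (cancellation).** Let `a = arc r ∈ A_P` be NON-singular, `λ = ‖∂G(r)‖`, and let `w` be a primitive direction
(`‖w‖ = 1`) that is NOT `x`-dominant. If an arc `b ∈ A_P` has `rv(b − a) = rv(σ²·w)` with `v(σ) < λ`, then, writing `b = arc(r+ε)`:
`‖ε‖ = v(σ)`, the leading terms of `∂G(r)·ε` CANCEL (`v(∂G(r)·ε) < λ‖ε‖`, else `b − a` would be `x`-dominant), and
`ρ = ε/σ` is an integral vector with `ρ² ≡ (w₁,…,w₄) (mod 𝔪)` and `v(∂G(r)·ρ) < λ` («`√w_q ∈ ker ∂G(r)` residually», report L3: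
`LV ⊆ k·e_x ⊕ Frob(ker ℓ̄_a)`). [folklore] -/
private theorem cancel_of_rvEq [PerfectRing K 2] {r : Fin 4 → K} (hr : arc r ∈ ball v (![0, 0, 1, 1, 0] : Fin 5 → K) 1)
    {σ : K} (hσ : σ ≠ 0) (hσlam : v σ < vnorm v (fun i => aeval r (pderiv i G)))
    {w : Fin 5 → K} (hw : vnorm v w = 1) (hw0 : ¬ IsDominant v 0 w)
    {b : Fin 5 → K} (hbX : eval b (fW : MvPolynomial (Fin 5) K) = 0) (hbB : b ∈ ball v (![0, 0, 1, 1, 0] : Fin 5 → K) 1)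
    (hrv : RvEq v (b - arc r) (σ ^ 2 • w)) :
    ∃ ρ : Fin 4 → K, (∀ j, v (ρ j) ≤ 1) ∧ (∀ j : Fin 4, v (ρ j ^ 2 - w j.succ) < 1) ∧
      v (∑ j, aeval r (pderiv j G) * ρ j) < vnorm v (fun i => aeval r (pderiv i G)) := by
  haveI : Fact (Nat.Prime 2) := ⟨Nat.prime_two⟩
  set ℓ : Fin 4 → K := fun j => aeval r (pderiv j G) with hℓ
  have hvσ : 0 < v σ := lt_of_le_of_ne zero_le ((Valuation.ne_zero_iff v).2 hσ).symm
  have hlam_pos : 0 < vnorm v ℓ := lt_trans hvσ hσlam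
  obtain ⟨r', rfl⟩ := exists_arc_eq hbX
  have hrint := integral_of_arc_mem_ball v hr
  have hr'int := integral_of_arc_mem_ball v hbB
  set ε : Fin 4 → K := r' - r with hε
  have hr' : r' = r + ε := by rw [hε]; abel
  set m := vnorm v ε with hm
  have hεv : ∀ j, v (ε j) ≤ m := le_vnorm v ε
  have hm1 : m ≤ 1 := (vnorm_le_iff v).2 fun j => by
    rw [hε, Pi.sub_apply]; exact (v.map_sub _ _).trans (max_le (hr'int j) (hrint j))
  -- Taylor
  set D := ∑ j, ℓ j * ε j with hD
  obtain ⟨hT, -, -⟩ := taylor_val_bound v G hrint hεv hm1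
  rw [← hr'] at hT
  change v (aeval r' G - aeval r G - D) ≤ m ^ 2 at hT
  have hDle : v D ≤ vnorm v ℓ * m := by
    refine v.map_sum_le fun j _ => ?_
    rw [map_mul]; exact mul_le_mul' (le_vnorm v ℓ j) (hεv j)
  -- sizes
  have hvn : vnorm v (arc r' - arc r) = v σ ^ 2 := by
    rw [← hrv.vnorm_eq, vnorm_smul, hw, mul_one, map_pow]
  have hq : ∀ j : Fin 4, v ((arc r' - arc r) j.succ) = v (ε j) ^ 2 := fun j => by
    rw [arc_sub_arc_succ, map_pow, hε, Pi.sub_apply]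
  have hndom : ¬ IsDominant v 0 (arc r' - arc r) := fun h =>
    hw0 ((IsDominant.smul_iff (by rw [map_pow]; exact pow_ne_zero 2 hvσ.ne')).1 (h.of_rvEq hrv))
  have hx_le : v ((arc r' - arc r) 0) ≤ m ^ 2 := by
    by_contra hlt
    apply hndom
    intro j hj
    obtain ⟨j', rfl⟩ := Fin.exists_succ_eq.2 hj
    rw [hq]
    exact lt_of_le_of_lt (pow_le_pow_left₀ zero_le (hεv j') 2) (not_le.1 hlt)
  have hm_eq : m = v σ := by
    apply eq_of_sq_eq_sq
    rw [← hvn]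
    refine le_antisymm ?_ ((vnorm_le_iff v).2 fun j => ?_)
    · obtain ⟨j₀, hj₀⟩ := exists_vnorm_eq v ε
      rw [hm, hj₀, ← hq]; exact le_vnorm v _ _
    · refine Fin.cases ?_ (fun j' => ?_) j
      · exact hx_le
      · rw [hq]; exact pow_le_pow_left₀ zero_le (hεv j') 2
  have hm_pos : 0 < m := by rw [hm_eq]; exact hvσ
  have hm_lt : m < vnorm v ℓ := by rw [hm_eq]; exact hσlam
  have hm2_lt : m ^ 2 < vnorm v ℓ * m := by
    rw [sq]; exact (mul_lt_mul_iff_of_pos_right hm_pos).2 hm_lt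
  -- cancellation: v D < λ m
  have hDlt : v D < vnorm v ℓ * m := by
    by_contra hge
    have hDeq : v D = vnorm v ℓ * m := le_antisymm hDle (not_lt.1 hge)
    apply hndom
    intro j hj
    obtain ⟨j', rfl⟩ := Fin.exists_succ_eq.2 hj
    have hx : (arc r' - arc r) 0 = D + (aeval r' G - aeval r G - D) := by rw [arc_sub_arc_zero]; ring
    rw [hx, v.map_add_eq_of_lt_left (by rw [hDeq]; exact hT.trans_lt hm2_lt), hDeq, hq]
    exact lt_of_le_of_lt (pow_le_pow_left₀ zero_le (hεv j') 2) hm2_lt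
  -- the coordinatewise congruence (ε_j)² ≡ σ² w_{j+1} below level m²
  have hcong : ∀ j : Fin 4, v (ε j ^ 2 - σ ^ 2 * w j.succ) < m ^ 2 := by
    intro j
    have hcoord : (arc r' - arc r) j.succ - (σ ^ 2 • w) j.succ = ε j ^ 2 - σ ^ 2 * w j.succ := by
      rw [arc_sub_arc_succ, Pi.smul_apply, smul_eq_mul, hε, Pi.sub_apply]
    rcases hrv with heq | hlt
    · have : ε j ^ 2 - σ ^ 2 * w j.succ = 0 := by rw [← hcoord, heq, sub_self]
      rw [this, Valuation.map_zero]; exact pow_pos hm_pos 2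
    · rw [hvn, ← hm_eq] at hlt
      rw [← hcoord, ← Pi.sub_apply]
      exact lt_of_le_of_lt (le_vnorm v _ _) hlt
  -- ρ = ε / σ
  refine ⟨fun j => ε j / σ, fun j => ?_, fun j => ?_, ?_⟩
  · rw [map_div₀, div_le_one₀ hvσ, ← hm_eq]; exact hεv j
  · have : (ε j / σ) ^ 2 - w j.succ = (ε j ^ 2 - σ ^ 2 * w j.succ) / σ ^ 2 := by
      field_simp
    rw [this, map_div₀, map_pow, ← hm_eq, div_lt_one₀ (pow_pos hm_pos 2)]
    exact hcong j
  · have : ∑ j, ℓ j * (ε j / σ) = D / σ := by rw [hD, Finset.sum_div]; exact Finset.sum_congr rfl fun j _ => by ring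
    rw [this, map_div₀, ← hm_eq, div_lt_iff₀ hm_pos]
    exact hDlt

end CharTwo

/-! ## §5 Assembly: no line is a riso-triviality direction of `B_{X₂,P}`; `rtd_P(X₂) = 0` -/

/-- `v(t + t⁴ + t⁵) = v(t)` and `v(t² + t⁶) = v(t²)` for `t ∈ 𝔪` (unit factors `1 + t³ + t⁴`, `1 + t⁴`). [folklore] -/
private theorem val_testArc_units {t : K} (ht1 : v t < 1) :
    v (t + t ^ 4 + t ^ 5) = v t ∧ v (t ^ 2 + t ^ 6) = v (t ^ 2) := by
  have ht' : v t ≤ 1 := ht1.le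
  constructor
  · have : t + t ^ 4 + t ^ 5 = t * (1 + (t ^ 3 + t ^ 4)) := by ring
    rw [this, map_mul, v.map_one_add_of_lt, mul_one]
    refine lt_of_le_of_lt (v.map_add _ _) (max_lt ?_ ?_) <;> rw [map_pow] <;>
      exact pow_lt_one₀ zero_le ht1 (by norm_num)
  · have : t ^ 2 + t ^ 6 = t ^ 2 * (1 + t ^ 4) := by ring
    rw [this, map_mul, v.map_one_add_of_lt, mul_one]
    rw [map_pow]; exact pow_lt_one₀ zero_le ht1 (by norm_num)

section CharTwo

variable [CharP K 2]

/-- **The core contradiction.** Over a perfect field of characteristic `2` with a non-trivial valuation: there is NO risometry of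
`A_P = X₂(K) ∩ B_P` onto a subset `C ⊂ B_P` invariant under the translations `s·w`, `s ∈ 𝔪`, for any primitive direction `w`
(`‖w‖ = 1`). Proof = the cell's report §9.4 made kernel: (i) L1/L2 — the straightener preserves the property `𝒫`, so it maps
singular arcs to a translation-invariant set; at `P` this produces a second singular arc `b` with `rv(b − P) = rv(t·w)`, and the
singular branch is `e_z`-dominant (`WQRiso.singular_near_P`, `WQRiso.zdom_of_singularType`), so `w` is `e_z`-dominant: `v(w_z) = 1`,
all other coordinates in `𝔪`; (ii) L3 at the three test arcs (`WQRiso.testArcW/Y/V`, levels `σ = t³`): `w_y ∈ 𝔪`, `w_w ∈ 𝔪`,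
`w_z + w_w ∈ 𝔪` — hence `w_z ∈ 𝔪`, contradiction. [folklore] -/
private theorem core [PerfectRing K 2] (hK : ∃ t : K, 0 < v t ∧ v t < 1) {w : Fin 5 → K} (hw : vnorm v w = 1)
    {φ : (Fin 5 → K) → (Fin 5 → K)} {C : Set (Fin 5 → K)}
    (hφ : IsRisometry v ({a | eval a (fW : MvPolynomial (Fin 5) K) = 0} ∩ ball v ![0, 0, 1, 1, 0] 1) C φ)
    (hT : ∀ c ∈ C, ∀ s : K, v s < 1 → c + s • w ∈ C) : False := by
  haveI : Fact (Nat.Prime 2) := ⟨Nat.prime_two⟩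
  obtain ⟨t, ht0, ht1⟩ := hK
  have ht : t ≠ 0 := (Valuation.ne_zero_iff v).1 ht0.ne'
  set AP : Set (Fin 5 → K) := {a | eval a (fW : MvPolynomial (Fin 5) K) = 0} ∩ ball v ![0, 0, 1, 1, 0] 1 with hAP
  -- Step A: the transport identity
  have stepA : ∀ a ∈ AP, ∀ s : K, v s < 1 → ∃ b ∈ AP, φ b = φ a + s • w ∧ RvEq v (b - a) (s • w) := by
    intro a ha s hs
    have hmem : φ a + s • w ∈ C := hT _ (hφ.bijOn.mapsTo ha) s hs
    rw [← hφ.image_eq] at hmem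
    obtain ⟨b, hb, hbeq⟩ := hmem
    refine ⟨b, hb, hbeq, ?_⟩
    have := hφ.rvEq hb ha
    rw [hbeq, add_sub_cancel_left] at this
    exact this.symm
  -- membership of arcs in AP
  have memAP : ∀ r : Fin 4 → K, v (aeval r G) < 1 → v (r 0) < 1 → v (r 1 - 1) < 1 → v (r 2 - 1) < 1 → v (r 3) < 1 →
      arc r ∈ AP := fun r hG h0 h1 h2 h3 =>
    ⟨eval_fW_arc r, (arc_mem_ball_iff v r).2 ⟨hG, h0, h1, h2, h3⟩⟩
  -- Step B: L2 at P
  obtain ⟨hPeq, hPsing⟩ := arc_rP (K := K)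
  have hP : arc (![0, 1, 1, 0] : Fin 4 → K) ∈ AP := by
    refine memAP _ ?_ ?_ ?_ ?_ ?_ <;> simp [aeval_G, zero_lt_one]
  have hnotP : ¬ PropP v AP (arc ![0, 1, 1, 0]) := not_propP_of_singular v ⟨t, ht0, ht1⟩ hP.2 hPsing
  obtain ⟨b₁, hb₁, hφb₁, hrv₁⟩ := stepA _ hP t ht1
  have hnotb₁ : ¬ PropP v AP b₁ := by
    intro hb
    apply hnotP
    have h1 : PropP v C (φ b₁) := (PropP.iff_map v hφ hb₁).1 hb
    rw [hφb₁] at h1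
    have h2 := PropP.add_const v (-(t • w)) h1
    rw [add_neg_cancel_right] at h2
    have h3 : PropP v C (φ (arc ![0, 1, 1, 0])) := by
      refine h2.mono v ?_
      rintro _ ⟨c, hc, rfl⟩
      have := hT c hc (-t) (by rw [Valuation.map_neg]; exact ht1)
      rwa [neg_smul] at this
    exact (PropP.iff_map v hφ hP).2 h3
  obtain ⟨r₁, rfl⟩ := exists_arc_eq hb₁.1
  have hsing₁ : ∀ i, aeval r₁ (pderiv i G) = 0 := by
    by_contra h
    simp only [not_forall] at h
    obtain ⟨i, hi⟩ := h
    exact hnotb₁ (propP_of_nonsingular v hb₁.2 hi)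
  obtain ⟨-, h10, h11, h12, h13⟩ := (arc_mem_ball_iff v r₁).1 hb₁.2
  obtain ⟨e0, e1, e2, -⟩ := aeval_pderiv_G r₁
  obtain ⟨hy₁, hu₁, hrel₁⟩ := singular_near_P v h10 h11 h12 h13 (by rw [← e0]; exact hsing₁ 0)
    (by rw [← e1]; exact hsing₁ 1) (by rw [← e2]; exact hsing₁ 2)
  have hne : (![0, 1, 1, 0] : Fin 4 → K) ≠ r₁ := by
    intro h
    have hzero : arc r₁ - arc ![0, 1, 1, 0] = 0 := by rw [h, sub_self]
    have : t • w = 0 := (hrv₁.eq_zero_iff).1 hzero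
    have hn : vnorm v (t • w) = v t := by rw [vnorm_smul, hw, mul_one]
    rw [this, vnorm_zero] at hn
    exact ht0.ne' hn.symm |>.elim
  have hzdom : IsDominant v 2 (arc r₁ - arc ![0, 1, 1, 0]) :=
    zdom_of_singularType v (by simp) (by simp) (by simp) (by simp) (by simp) hy₁ hu₁ hrel₁ h11 h12 hne
  have hw2 : IsDominant v 2 w :=
    (IsDominant.smul_iff ((Valuation.ne_zero_iff v).2 ht)).1 (hzdom.of_rvEq hrv₁)
  have hw0 : ¬ IsDominant v 0 w := fun h => by
    have := h.eq_of_isDominant hw2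
    exact absurd this (by decide)
  have hwz : v (w 2) = 1 := by rw [← hw2.vnorm_eq, hw]
  have hwy : v (w 1) < v (w 2) := hw2 1 (by decide)
  have hww : v (w 3) < v (w 2) := hw2 3 (by decide)
  -- Step D: the three test arcs with σ = t³
  set σ : K := t ^ 3 with hσ
  have hσ0 : σ ≠ 0 := pow_ne_zero 3 ht
  have hvσ : v σ = v t ^ 3 := by rw [hσ, map_pow]
  have hσ2 : v (σ ^ 2) < 1 := by rw [map_pow, hvσ, ← pow_mul]; exact pow_lt_one₀ zero_le ht1 (by norm_num)
  have ht2 : v t ^ 3 < v t ^ 2 := pow_lt_pow_right_of_lt_one₀ ht0 ht1 (by norm_num)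
  have ht3 : v t ^ 3 < v t := by
    calc v t ^ 3 < v t ^ 1 := pow_lt_pow_right_of_lt_one₀ ht0 ht1 (by norm_num)
      _ = v t := pow_one _
  obtain ⟨huW, huV⟩ := val_testArc_units v ht1
  -- arc W
  obtain ⟨gW, dW0, dW1, dW2, dW3⟩ := testArcW (K := K) t
  have hWmem : arc (![0, 1, 1 + t, 0] : Fin 4 → K) ∈ AP := by
    refine memAP _ ?_ ?_ ?_ ?_ ?_ <;> simp [gW, ht1]
  have hWnorm : vnorm v (fun i => aeval (![0, 1, 1 + t, 0] : Fin 4 → K) (pderiv i G)) = v t := by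
    refine le_antisymm ((vnorm_le_iff v).2 fun j => ?_) ?_
    · fin_cases j <;> simp [dW0, dW1, dW2, dW3, huW]
    · have := le_vnorm v (fun i => aeval (![0, 1, 1 + t, 0] : Fin 4 → K) (pderiv i G)) 0
      simpa [dW0, huW] using this
  obtain ⟨bW, hbW, -, hrvW⟩ := stepA _ hWmem (σ ^ 2) hσ2
  obtain ⟨ρW, hρW1, hρW2, hρW3⟩ := cancel_of_rvEq v hWmem.2 hσ0 (by rw [hWnorm, hvσ]; exact ht3) hw hw0 hbW.1 hbW.2 hrvW
  have hwy' : v (w 1) < 1 := by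
    rw [hWnorm, Fin.sum_univ_four, dW0, dW1, dW2, dW3] at hρW3
    simp only [zero_mul, add_zero, map_mul, huW] at hρW3
    have hρ : v (ρW 0) < 1 := by
      by_contra h
      exact absurd hρW3 (not_lt.2 (le_mul_of_one_le_right' (not_lt.1 h)))
    have := hρW2 0
    have e : w 1 = ρW 0 ^ 2 - (ρW 0 ^ 2 - w (0 : Fin 4).succ) := by simp
    rw [e]
    exact lt_of_le_of_lt (v.map_sub _ _) (max_lt (by rw [map_pow]; exact pow_lt_one₀ zero_le hρ two_ne_zero) this)
  -- arc Y
  obtain ⟨gY, dY0, dY1, dY2, dY3⟩ := testArcY (K := K) t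
  have hYmem : arc (![t, 1, 1, 0] : Fin 4 → K) ∈ AP := by
    refine memAP _ ?_ ?_ ?_ ?_ ?_ <;> simp [gY, ht1]
    exact pow_lt_one₀ zero_le ht1 (by norm_num)
  have hYnorm : vnorm v (fun i => aeval (![t, 1, 1, 0] : Fin 4 → K) (pderiv i G)) = v t := by
    refine le_antisymm ((vnorm_le_iff v).2 fun j => ?_) ?_
    · fin_cases j <;> simp [dY0, dY1, dY2, dY3]
      exact pow_le_of_le_one zero_le ht1.le (by norm_num)
    · have := le_vnorm v (fun i => aeval (![t, 1, 1, 0] : Fin 4 → K) (pderiv i G)) 2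
      simpa [dY2] using this
  obtain ⟨bY, hbY, -, hrvY⟩ := stepA _ hYmem (σ ^ 2) hσ2
  obtain ⟨ρY, hρY1, hρY2, hρY3⟩ := cancel_of_rvEq v hYmem.2 hσ0 (by rw [hYnorm, hvσ]; exact ht3) hw hw0 hbY.1 hbY.2 hrvY
  have hww' : v (w 3) < 1 := by
    rw [hYnorm, Fin.sum_univ_four, dY0, dY1, dY2, dY3] at hρY3
    simp only [zero_mul, add_zero] at hρY3
    -- hρY3 : v (t^10 * ρY 0 + t * ρY 2) < v t
    have e : t ^ 10 * ρY 0 + t * ρY 2 = t * (t ^ 9 * ρY 0 + ρY 2) := by ring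
    rw [e, map_mul] at hρY3
    have h' : v (t ^ 9 * ρY 0 + ρY 2) < 1 := by
      by_contra h
      exact absurd hρY3 (not_lt.2 (le_mul_of_one_le_right' (not_lt.1 h)))
    have hρ : v (ρY 2) < 1 := by
      have e2 : ρY 2 = (t ^ 9 * ρY 0 + ρY 2) - t ^ 9 * ρY 0 := by ring
      rw [e2]
      refine lt_of_le_of_lt (v.map_sub _ _) (max_lt h' ?_)
      rw [map_mul, map_pow]
      calc v t ^ 9 * v (ρY 0) ≤ v t ^ 9 * 1 := mul_le_mul' le_rfl (hρY1 0)
        _ < 1 := by rw [mul_one]; exact pow_lt_one₀ zero_le ht1 (by norm_num)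
    have := hρY2 2
    have e3 : w 3 = ρY 2 ^ 2 - (ρY 2 ^ 2 - w (2 : Fin 4).succ) := by simp
    rw [e3]
    exact lt_of_le_of_lt (v.map_sub _ _) (max_lt (by rw [map_pow]; exact pow_lt_one₀ zero_le hρ two_ne_zero) this)
  -- arc V
  obtain ⟨gV, dV0, dV1, dV2, dV3⟩ := testArcV (K := K) t
  have hVmem : arc (![0, 1, 1, t] : Fin 4 → K) ∈ AP := by
    refine memAP _ ?_ ?_ ?_ ?_ ?_ <;> simp [gV, ht1]
    rw [huV, map_pow]; exact pow_lt_one₀ zero_le ht1 two_ne_zero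
  have hVnorm : vnorm v (fun i => aeval (![0, 1, 1, t] : Fin 4 → K) (pderiv i G)) = v t ^ 2 := by
    refine le_antisymm ((vnorm_le_iff v).2 fun j => ?_) ?_
    · fin_cases j <;> simp [dV0, dV1, dV2, dV3, huV]
      exact pow_le_pow_right_of_le_one' ht1.le (by norm_num)
    · have := le_vnorm v (fun i => aeval (![0, 1, 1, t] : Fin 4 → K) (pderiv i G)) 1
      simpa [dV1] using this
  obtain ⟨bV, hbV, -, hrvV⟩ := stepA _ hVmem (σ ^ 2) hσ2
  obtain ⟨ρV, hρV1, hρV2, hρV3⟩ := cancel_of_rvEq v hVmem.2 hσ0 (by rw [hVnorm, hvσ]; exact ht2) hw hw0 hbV.1 hbV.2 hrvV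
  have hwzw : v (w 2 + w 3) < 1 := by
    rw [hVnorm, Fin.sum_univ_four, dV0, dV1, dV2, dV3] at hρV3
    simp only [zero_mul, add_zero] at hρV3
    have e : t ^ 4 * ρV 0 + t ^ 2 * ρV 1 + (t ^ 2 + t ^ 6) * ρV 2 =
        t ^ 2 * (t ^ 2 * ρV 0 + ρV 1 + (1 + t ^ 4) * ρV 2) := by ring
    rw [e, map_mul, map_pow] at hρV3
    have h' : v (t ^ 2 * ρV 0 + ρV 1 + (1 + t ^ 4) * ρV 2) < 1 := by
      by_contra h
      exact absurd hρV3 (not_lt.2 (le_mul_of_one_le_right' (not_lt.1 h)))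
    have hρ : v (ρV 1 + ρV 2) < 1 := by
      have e2 : ρV 1 + ρV 2 = (t ^ 2 * ρV 0 + ρV 1 + (1 + t ^ 4) * ρV 2) - (t ^ 2 * ρV 0 + t ^ 4 * ρV 2) := by ring
      rw [e2]
      refine lt_of_le_of_lt (v.map_sub _ _) (max_lt h' (lt_of_le_of_lt (v.map_add _ _) (max_lt ?_ ?_)))
      · rw [map_mul, map_pow]
        calc v t ^ 2 * v (ρV 0) ≤ v t ^ 2 * 1 := mul_le_mul' le_rfl (hρV1 0)
          _ < 1 := by rw [mul_one]; exact pow_lt_one₀ zero_le ht1 (by norm_num)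
      · rw [map_mul, map_pow]
        calc v t ^ 4 * v (ρV 2) ≤ v t ^ 4 * 1 := mul_le_mul' le_rfl (hρV1 2)
          _ < 1 := by rw [mul_one]; exact pow_lt_one₀ zero_le ht1 (by norm_num)
    have h1 := hρV2 1
    have h2 := hρV2 2
    have e3 : w 2 + w 3 = (ρV 1 + ρV 2) ^ 2 - (ρV 1 ^ 2 - w (1 : Fin 4).succ) - (ρV 2 ^ 2 - w (2 : Fin 4).succ) := by
      rw [add_pow_char]; simp
    rw [e3]
    refine lt_of_le_of_lt (v.map_sub _ _) (max_lt (lt_of_le_of_lt (v.map_sub _ _) (max_lt ?_ h1)) h2)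
    rw [map_pow]; exact pow_lt_one₀ zero_le hρ two_ne_zero
  -- contradiction: v (w 2) ≤ max (v (w 2 + w 3)) (v (w 3)) < 1 = v (w 2)
  have : v (w 2) < 1 := by
    have e : w 2 = (w 2 + w 3) - w 3 := by ring
    rw [e]
    exact lt_of_le_of_lt (v.map_sub _ _) (max_lt hwzw hww')
  exact absurd hwz this.ne

end CharTwo

section Main

variable [CharP K 2] [PerfectRing K 2]

/-- **No primitive direction is a riso-triviality direction of `B_{X₂,P}` (translation form).** `K` a perfect field of
characteristic `2` with a non-trivial valuation `v`; `X₂ = V(fW) ⊂ 𝔸⁵`, `P = (0,0,1,1,0)`, `B_P` the ball of arcs based at `P`.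
For every `w ∈ K⁵` with `‖w‖_v = 1` there is NO risometry (Def. 3.15) of `X₂(K) ∩ B_P` onto a set `C` with `C + s·w ⊆ C` for
all `s ∈ 𝔪`. (derived here: the cell's hand lemmas (L1)–(L3) and §9.4 of `KILL-TEST-K3.2prime.md`, kernel-checked, over an
arbitrary perfect valued field instead of `k((t^ℚ))`) [cite: Monreal2026, Def. 3.14, Def. 3.15 and Def. 3.17] -/
theorem wq_no_translation_invariant_straightening (hK : ∃ t : K, 0 < v t ∧ v t < 1) {w : Fin 5 → K}
    (hw : vnorm v w = 1) {φ : (Fin 5 → K) → (Fin 5 → K)} {C : Set (Fin 5 → K)}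
    (hφ : IsRisometry v ({a | eval a (fW : MvPolynomial (Fin 5) K) = 0} ∩ ball v ![0, 0, 1, 1, 0] 1) C φ)
    (hT : ∀ c ∈ C, ∀ s : K, v s < 1 → c + s • w ∈ C) : False :=
  core v hK hw hφ hT

/-- **`X₂(K) ∩ B_P` is `W`-riso-trivial on `B_P` for NO non-zero `κ`-subspace `W ⊂ 𝔸⁵_κ`** (Def. 3.17), for every coefficient
field `κ → K` (in the source: the residue field with its section, Def. 2.4), every perfect field `K` of characteristic `2` and
every non-trivial valuation on `K`. From `wq_no_translation_invariant_straightening` applied to the primitive normalisation of a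
non-zero vector of `W`. (derived here) [cite: Monreal2026, Def. 3.17] -/
theorem wq_not_isRisoTrivialOn_P (hK : ∃ t : K, 0 < v t ∧ v t < 1) (κ : Type*) [Field κ] [Algebra κ K]
    {W : Submodule κ (Fin 5 → κ)} (hW : W ≠ ⊥) :
    ¬ IsRisoTrivialOn v κ {a : Fin 5 → K | eval a (fW : MvPolynomial (Fin 5) K) = 0} ![0, 0, 1, 1, 0] 1 W := by
  rintro ⟨φ, C, hC, hφ, hTI⟩
  obtain ⟨wb, hwbW, hwb0⟩ := Submodule.exists_mem_ne_zero_of_ne_bot hW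
  set w₁ : Fin 5 → K := fun i => algebraMap κ K (wb i) with hw₁
  have hw₁0 : 0 < vnorm v w₁ := by
    obtain ⟨i, hi⟩ : ∃ i, wb i ≠ 0 := by
      by_contra h
      simp only [not_exists, not_not] at h
      exact hwb0 (funext h)
    have : 0 < v (w₁ i) := by
      refine lt_of_le_of_ne zero_le (Ne.symm ((Valuation.ne_zero_iff v).2 ?_))
      rw [hw₁]; exact (map_ne_zero (algebraMap κ K)).2 hi
    exact lt_of_lt_of_le this (le_vnorm v w₁ i)
  obtain ⟨i₀, hi₀⟩ := exists_vnorm_eq v w₁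
  set c : K := w₁ i₀ with hc
  have hc0 : c ≠ 0 := (Valuation.ne_zero_iff v).1 (by rw [← hi₀]; exact hw₁0.ne')
  set w : Fin 5 → K := c⁻¹ • w₁ with hwdef
  have hw : vnorm v w = 1 := by
    rw [hwdef, vnorm_smul, map_inv₀, ← hi₀, inv_mul_cancel₀ hw₁0.ne']
  refine core v hK hw hφ fun c' hc' s hs => ?_
  have hsw : s • w = (s * c⁻¹) • w₁ := by rw [hwdef, smul_smul]
  have hmem : (s * c⁻¹) • w₁ ∈ subspaceBall v κ W 1 := by
    refine smul_mem_subspaceBall hwbW (s * c⁻¹) ?_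
    rw [← hsw, vnorm_smul, hw, mul_one]; exact hs
  have := hTI.add_mem ⟨hc', hC hc'⟩ hmem
  rw [← hsw] at this
  exact this.1

/-- **`rtd_{B_P}(X₂(K)) = 0`** (Def. 3.17): the riso-triviality dimension of the arc ball of the W-Q fourfold at
`P = (0,0,1,1,0)` vanishes — for every perfect field `K` of characteristic `2`, every non-trivial valuation on `K`, every
coefficient field `κ`. This is the value «`rtd_P(X₂) = 0`» of the barrier `RisoBlindAlongInseparableOrbit` (there quoted from the
cell's hand computation), now kernel-checked; with the source's intrinsic `rtsp_x` (Def. 4.5/4.7, a subspace of every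
`rtsp_{B_{X_κ,x}}`) it forces `rtd_P(X₂) = 0` in the sense of Def. 4.7 whenever that object exists. (derived here)
[cite: Monreal2026, Def. 3.17 and Def. 4.7] -/
theorem wq_rtd_P_eq_zero (hK : ∃ t : K, 0 < v t ∧ v t < 1) (κ : Type*) [Field κ] [Algebra κ K] :
    rtd v κ {a : Fin 5 → K | eval a (fW : MvPolynomial (Fin 5) K) = 0} ![0, 0, 1, 1, 0] 1 = 0 :=
  rtd_eq_zero_of fun _ hW => wq_not_isRisoTrivialOn_P v hK κ hW

omit [PerfectRing K 2] in
/-- The ball `B_P` meets `X₂(K)` (at `P`), so `rtd = 0` above is the genuine value of Def. 3.17 (the maximum over a family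
containing `V = 0`), not the empty-supremum default. (derived here) [cite: Monreal2026, Def. 3.17] -/
theorem wq_P_mem : (![0, 0, 1, 1, 0] : Fin 5 → K) ∈
    {a : Fin 5 → K | eval a (fW : MvPolynomial (Fin 5) K) = 0} ∩ ball v ![0, 0, 1, 1, 0] 1 := by
  obtain ⟨hPeq, -⟩ := arc_rP (K := K)
  have h : arc (![0, 1, 1, 0] : Fin 4 → K) ∈
      {a : Fin 5 → K | eval a (fW : MvPolynomial (Fin 5) K) = 0} ∩ ball v ![0, 0, 1, 1, 0] 1 :=
    ⟨eval_fW_arc _, (arc_mem_ball_iff v _).2 (by simp [aeval_G])⟩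
  rwa [hPeq] at h

end Main

end RisoBlind

open RisoBlind Literature.AlgebraicGeometry.Resolution.Riso Literature.AlgebraicGeometry.Hironaka2017.WQWitness in
/-- **Barrier «RisoBlindAlongInseparableOrbit» — kernel upgrade of the rtd-value at `P`.** For EVERY perfect field `K` of
characteristic `2`, EVERY non-trivial valuation `v` on `K` (any value group) and EVERY coefficient field `κ → K`: on the W-Q
fourfold `X₂ = V(fW) ⊂ 𝔸⁵`, `fW = x² + wv⁶ + zw⁵v² + yz²wv⁴ + yz³w⁵ + yz⁹ + y⁴zw²v² + y¹¹`, at the point `P = (0,0,1,1,0)` of the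
purely inseparable torus orbit `Γ₂`, the riso-triviality dimension of the arc ball `B_{X₂,P}` (Monreal Def. 3.17, typed in
`Literature.AlgebraicGeometry.Resolution.Riso.rtd`) is `0`, and no non-zero `κ`-subspace is a riso-triviality direction. This
replaces scope-caveat (b) of `Monreal2026_risoBlindAlongInseparableOrbit` («`rtd_P = 0` rests on the cell's hand lemmas
(L1)–(L3) … NOT kernel-checked») for the point `P`: the hand lemmas are now the private theorems `PropP.map` /
`PropP.add_const` (L1), `propP_of_nonsingular` / `not_propP_of_singular` + `WQRiso.singular_near_P` / `WQRiso.zdom_of_singularType`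
(L2), `cancel_of_rvEq` (L3) of this file, assembled in `wq_no_translation_invariant_straightening`. HONEST FRAMING: the
source's admissible fields (Def. 2.4: algebraically closed, spherically complete) are perfect valued fields, so they are
covered; the intrinsic `rtsp_P(X₂)` of Def. 4.7 — IF it exists (Q. 6.5 open in characteristic `p`) — is then `0`; the value
`rtd_0(X₂) = 0` at the ORIGIN (report §9.3, eight singular branches) is NOT upgraded here and stays hand-labelled in the barrier;
nothing here bears on Monreal's characteristic-0 theorems, on Question 1.6 in general, on resolution of singularities in
characteristic `p`, or on H. Hironaka's 2017 manuscript (under adjudication, D-0012). Cell res-hironaka (D-0089), rung L,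
barrier #4, seat res-type-062; second reading of `KILL-TEST-K3.2prime.md` §9 ADDENDUM A2 (res-L1-k32 g3) — READ-AGREE for the
cells «rtd(P) = 0» and «(V-a) does not separate `0` from `P` via a positive rtd at `P`». (derived here)
[cite: Monreal2026, Def. 3.14, Def. 3.15, Def. 3.17 and Def. 4.7] -/
theorem Monreal2026_risoBlindAlongInseparableOrbit_rtdP :
    ∀ (K : Type*) [Field K] [CharP K 2] [PerfectRing K 2] (Γ₀ : Type*) [LinearOrderedCommGroupWithZero Γ₀]
      (v : Valuation K Γ₀), (∃ t : K, 0 < v t ∧ v t < 1) →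
      ∀ (κ : Type*) [Field κ] [Algebra κ K],
        (![0, 0, 1, 1, 0] : Fin 5 → K) ∈ {a : Fin 5 → K | MvPolynomial.eval a (fW : MvPolynomial (Fin 5) K) = 0} ∩
            ball v ![0, 0, 1, 1, 0] 1 ∧
        (∀ W : Submodule κ (Fin 5 → κ), W ≠ ⊥ →
          ¬ IsRisoTrivialOn v κ {a : Fin 5 → K | MvPolynomial.eval a (fW : MvPolynomial (Fin 5) K) = 0}
            ![0, 0, 1, 1, 0] 1 W) ∧
        rtd v κ {a : Fin 5 → K | MvPolynomial.eval a (fW : MvPolynomial (Fin 5) K) = 0} ![0, 0, 1, 1, 0] 1 = 0 :=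
  fun _ _ _ _ _ _ v hK κ _ _ => ⟨wq_P_mem v, fun _ hW => wq_not_isRisoTrivialOn_P v hK κ hW, wq_rtd_P_eq_zero v hK κ⟩

/-! ## §6 (v2) The ORIGIN: `rtd_0(X₂) = 0` without classifying the singular branches through `0`

Report §9.3 obtains `rtd_0 = 0` from two singular branches off the origin (`w`-axis: `LV = k^×e_w`; `Γ₂`: `LV = k^×e_z`),
which needs the list of singular arcs near those branches. The kernel route below avoids any classification: L2 at the
ORIGIN ARC itself (`a = 0`, singular) produces, for every deep level, a SINGULAR arc `b ≠ 0` based at `0` with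
`rv(b) = rv(s·w)`; (α) `b − 0` is never `x`-dominant (singular base), so `w` is not `x`-dominant; (β) «the `v`-coordinate attains
the valuative size» is an rv-class invariant, and a non-zero singular arc based at `0` never has it (`∂_wG = u⁶ + zw⁴u² + yz²u⁴ +
yz³w⁴`: `u⁶` would be the unique shallowest term), so `v(w_v) < 1`; (γ) L3 at the non-singular arcs `r = (t,0,0,0)`, `(0,0,0,t)`,
`(0,0,t,t²)` based at `0` (gradients `(t¹⁰,0,0,0)`, `(0,0,t⁶,0)`, `(0,t⁹,t¹²,0)`) gives `w_y, w_w, w_z ∈ 𝔪`; with `‖w‖ = 1` this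
forces `v(w_x) = 1`, i.e. `w` IS `x`-dominant — contradiction. -/

namespace RisoBlind

open MvPolynomial Finset
open Literature.AlgebraicGeometry.Resolution Literature.AlgebraicGeometry.Resolution.Riso
open Literature.AlgebraicGeometry.Hironaka2017 Literature.AlgebraicGeometry.Hironaka2017.WQWitness
open Literature.AlgebraicGeometry.Hironaka2017.WQRiso

variable {K : Type*} [Field K] {Γ₀ : Type*} [LinearOrderedCommGroupWithZero Γ₀] (v : Valuation K Γ₀)

/-- «Coordinate `i` attains the valuative size» is an rv-class invariant. [folklore] -/
private theorem attains_of_rvEq {n : ℕ} {δ δ' : Fin n → K} {i : Fin n} (h : RvEq v δ δ') (hi : v (δ i) = vnorm v δ) :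
    v (δ' i) = vnorm v δ' := by
  rcases h with rfl | hlt
  · exact hi
  · rw [RvEq.vnorm_eq (RvEq.of_vnorm_sub_lt hlt)]
    have hd : v ((δ - δ') i) < v (δ i) := by rw [hi]; exact lt_of_le_of_lt (le_vnorm v _ i) hlt
    have : δ' i = δ i + -((δ - δ') i) := by simp
    rw [this, v.map_add_eq_of_lt_left (by rw [Valuation.map_neg]; exact hd), hi]

/-- A non-zero SINGULAR arc based at `0` never has its `v`-coordinate attaining the valuative size: if
`v(u) ≥ v(y), v(z), v(w)` for `r = (y,z,w,u) ∈ 𝔪⁴` and `∂_wG(r) = u⁶ + zw⁴u² + yz²u⁴ + yz³w⁴ = 0`, then `r = 0` (`u⁶` is the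
unique shallowest term). [folklore] -/
private theorem eq_zero_of_singular_vmax {r : Fin 4 → K} (hlt : ∀ i, v (r i) < 1) (hmax : ∀ i, v (r i) ≤ v (r 3))
    (e2 : r 3 ^ 6 + r 1 * r 2 ^ 4 * r 3 ^ 2 + r 0 * r 1 ^ 2 * r 3 ^ 4 + r 0 * r 1 ^ 3 * r 2 ^ 4 = 0) : r = 0 := by
  set u := r 3 with hu
  by_cases hu0 : u = 0
  · funext i
    have : v (r i) = 0 := le_antisymm (by simpa [hu0] using hmax i) zero_le
    exact (Valuation.zero_iff v).1 this
  · exfalso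
    have hυ : 0 < v u := lt_of_le_of_ne zero_le ((Valuation.ne_zero_iff v).2 hu0).symm
    have hυ1 : v u < 1 := hlt 3
    -- every other term is strictly deeper than u⁶
    have h7 : v u ^ 7 < v u ^ 6 := pow_lt_pow_right_of_lt_one₀ hυ hυ1 (by norm_num)
    have hb : ∀ x : K, v x ≤ v u → ∀ k : ℕ, v (x ^ k) ≤ v u ^ k := fun x hx k => by
      rw [map_pow]; exact pow_le_pow_left₀ zero_le hx k
    have t1 : v (r 1 * r 2 ^ 4 * r 3 ^ 2) < v u ^ 6 := by
      rw [map_mul, map_mul]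
      calc v (r 1) * v (r 2 ^ 4) * v (r 3 ^ 2) ≤ v u * v u ^ 4 * v u ^ 2 :=
            mul_le_mul' (mul_le_mul' (hmax 1) (hb _ (hmax 2) 4)) (hb _ le_rfl 2)
        _ = v u ^ 7 := by rw [← pow_succ', ← pow_add]
        _ < v u ^ 6 := h7
    have t2 : v (r 0 * r 1 ^ 2 * r 3 ^ 4) < v u ^ 6 := by
      rw [map_mul, map_mul]
      calc v (r 0) * v (r 1 ^ 2) * v (r 3 ^ 4) ≤ v u * v u ^ 2 * v u ^ 4 :=
            mul_le_mul' (mul_le_mul' (hmax 0) (hb _ (hmax 1) 2)) (hb _ le_rfl 4)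
        _ = v u ^ 7 := by rw [← pow_succ', ← pow_add]
        _ < v u ^ 6 := h7
    have t3 : v (r 0 * r 1 ^ 3 * r 2 ^ 4) < v u ^ 6 := by
      rw [map_mul, map_mul]
      calc v (r 0) * v (r 1 ^ 3) * v (r 2 ^ 4) ≤ v u * v u ^ 3 * v u ^ 4 :=
            mul_le_mul' (mul_le_mul' (hmax 0) (hb _ (hmax 1) 3)) (hb _ (hmax 2) 4)
        _ = v u ^ 8 := by rw [← pow_succ', ← pow_add]
        _ ≤ v u ^ 7 := pow_le_pow_right_of_le_one' hυ1.le (by norm_num)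
        _ < v u ^ 6 := h7
    have hrest : v (r 1 * r 2 ^ 4 * r 3 ^ 2 + r 0 * r 1 ^ 2 * r 3 ^ 4 + r 0 * r 1 ^ 3 * r 2 ^ 4) < v (u ^ 6) := by
      rw [map_pow]
      exact lt_of_le_of_lt (v.map_add _ _) (max_lt (lt_of_le_of_lt (v.map_add _ _) (max_lt t1 t2)) t3)
    have hsum : v (u ^ 6 + (r 1 * r 2 ^ 4 * r 3 ^ 2 + r 0 * r 1 ^ 2 * r 3 ^ 4 + r 0 * r 1 ^ 3 * r 2 ^ 4)) = v (u ^ 6) :=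
      v.map_add_eq_of_lt_left hrest
    have e2' : u ^ 6 + (r 1 * r 2 ^ 4 * r 3 ^ 2 + r 0 * r 1 ^ 2 * r 3 ^ 4 + r 0 * r 1 ^ 3 * r 2 ^ 4) = 0 := by
      rw [← e2]; ring
    rw [e2', Valuation.map_zero, map_pow] at hsum
    exact absurd hsum.symm (pow_ne_zero 6 hυ.ne')

section OriginCharTwo

variable [CharP K 2]

/-- `G(r) ∈ 𝔪²`-type bound: for `r ∈ 𝒪⁴` with `‖r‖ ≤ m ≤ 1`, `v(G(r)) ≤ m²` (Taylor at the origin: `G(0) = 0`, `∂G(0) = 0`).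
[folklore] -/
private theorem val_G_le_sq {r : Fin 4 → K} {m : Γ₀} (hr : ∀ i, v (r i) ≤ m) (hm : m ≤ 1) : v (aeval r G) ≤ m ^ 2 := by
  obtain ⟨hT, -, -⟩ := taylor_val_bound v G (r := 0) (ε := r) (m := m) (fun _ => by simp) hr hm
  have hG0 : aeval (0 : Fin 4 → K) G = 0 := by rw [aeval_G]; simp
  obtain ⟨e0, e1, e2, e3⟩ := aeval_pderiv_G (K := K) 0
  have hd : ∀ j, aeval (0 : Fin 4 → K) (pderiv j G) = 0 := by
    intro j; fin_cases j
    · rw [show ((⟨0, by norm_num⟩ : Fin 4)) = 0 from rfl, e0]; simp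
    · rw [show ((⟨1, by norm_num⟩ : Fin 4)) = 1 from rfl, e1]; simp
    · rw [show ((⟨2, by norm_num⟩ : Fin 4)) = 2 from rfl, e2]; simp
    · rw [show ((⟨3, by norm_num⟩ : Fin 4)) = 3 from rfl, e3]
  rw [zero_add, hG0, sub_zero] at hT
  simp only [hd, zero_mul, Finset.sum_const_zero, sub_zero] at hT
  exact hT

/-- `arc r` is based at the origin iff all square-root coordinates lie in `𝔪` (then `G(r) ∈ 𝔪` automatically). [folklore] -/
private theorem arc_mem_ball_zero_iff (r : Fin 4 → K) : arc r ∈ ball v (0 : Fin 5 → K) 1 ↔ ∀ i, v (r i) < 1 := by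
  rw [mem_ball_iff, sub_zero, vnorm_lt_iff v zero_lt_one, Fin.forall_fin_succ]
  simp only [arc_zero, arc_succ, map_pow, sq_lt_one_iff']
  constructor
  · exact fun h => h.2
  · intro h
    refine ⟨?_, h⟩
    obtain ⟨i₀, hi₀⟩ := exists_vnorm_eq v r
    have hm : vnorm v r < 1 := by rw [hi₀]; exact h i₀
    exact (val_G_le_sq v (le_vnorm v r) hm.le).trans_lt (by
      calc vnorm v r ^ 2 ≤ vnorm v r := by
            rw [sq]; exact mul_le_of_le_one_left' hm.le
        _ < 1 := hm)

/-- Square-root coordinates of an arc based at `0` are integral. [folklore] -/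
private theorem integral_of_arc_mem_ball_zero {r : Fin 4 → K} (h : arc r ∈ ball v (0 : Fin 5 → K) 1) :
    ∀ i, v (r i) ≤ 1 := fun i => ((arc_mem_ball_zero_iff v r).1 h i).le

/-- At a SINGULAR base arc `a = arc r` no difference `arc r' − arc r` is `x`-dominant (Taylor: the `x`-coordinate is
`O(‖r' − r‖²)` while the other coordinates are the squares `(r' − r)²`). [folklore] -/
private theorem not_xdom_of_singular_base {r r' : Fin 4 → K} (hr : ∀ i, v (r i) ≤ 1) (hr' : ∀ i, v (r' i) ≤ 1)
    (hsing : ∀ i, aeval r (pderiv i G) = 0) : ¬ IsDominant v 0 (arc r' - arc r) := by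
  intro hdom
  set ε : Fin 4 → K := r' - r with hε
  have hr'e : r' = r + ε := by rw [hε]; abel
  have hεv : ∀ j, v (ε j) ≤ vnorm v ε := le_vnorm v ε
  have hm1 : vnorm v ε ≤ 1 := (vnorm_le_iff v).2 fun j => by
    rw [hε, Pi.sub_apply]; exact (v.map_sub _ _).trans (max_le (hr' j) (hr j))
  obtain ⟨hT, -, -⟩ := taylor_val_bound v G hr hεv hm1
  have hsum : ∑ j, aeval r (pderiv j G) * ε j = 0 := Finset.sum_eq_zero fun j _ => by rw [hsing j, zero_mul]
  rw [hsum, sub_zero, ← hr'e] at hT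
  obtain ⟨j₀, hj₀⟩ := exists_vnorm_eq v ε
  have hq : v ((arc r' - arc r) j₀.succ) = vnorm v ε ^ 2 := by
    rw [arc_sub_arc_succ, map_pow, hj₀, hε, Pi.sub_apply]
  have hlt := hdom j₀.succ (Fin.succ_ne_zero j₀)
  rw [hq, arc_sub_arc_zero] at hlt
  exact absurd (hT.trans_lt hlt) (lt_irrefl _)

/-- Non-singular arcs based at `0` satisfy `𝒫` (as `propP_of_nonsingular`, base `0`). [folklore] -/
private theorem propP_of_nonsingular_zero {r : Fin 4 → K} (hr : arc r ∈ ball v (0 : Fin 5 → K) 1)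
    {i : Fin 4} (hi : aeval r (pderiv i G) ≠ 0) :
    PropP v ({a | eval a (fW : MvPolynomial (Fin 5) K) = 0} ∩ ball v 0 1) (arc r) := by
  haveI : Fact (Nat.Prime 2) := ⟨Nat.prime_two⟩
  set ℓ : Fin 4 → K := fun j => aeval r (pderiv j G) with hℓ
  obtain ⟨i₀, hi₀⟩ := exists_vnorm_eq v ℓ
  have hlam_pos : 0 < vnorm v ℓ := by
    have : 0 < v (ℓ i) := lt_of_le_of_ne zero_le ((Valuation.ne_zero_iff v).2 hi).symm
    exact lt_of_lt_of_le this (le_vnorm v ℓ i)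
  have hℓi₀ : ℓ i₀ ≠ 0 := (Valuation.ne_zero_iff v).1 (by rw [← hi₀]; exact hlam_pos.ne')
  have hrlt := (arc_mem_ball_zero_iff v r).1 hr
  have hrint := integral_of_arc_mem_ball_zero v hr
  have hlam_le : vnorm v ℓ ≤ 1 := vnorm_grad_le_one v hrint
  refine ⟨ℓ i₀ ^ 2, pow_ne_zero 2 hℓi₀, fun s hs hslt => ?_⟩
  rw [map_pow, ← hi₀] at hslt
  set ε : Fin 4 → K := Pi.single i₀ (s / ℓ i₀) with hε
  set ν : Γ₀ := v (s / ℓ i₀) with hν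
  have hvs : 0 < v s := lt_of_le_of_ne zero_le ((Valuation.ne_zero_iff v).2 hs).symm
  have hνlam : ν * vnorm v ℓ = v s := by rw [hν, map_div₀, ← hi₀, div_mul_cancel₀ _ hlam_pos.ne']
  have hεv : ∀ j, v (ε j) ≤ ν := by
    intro j
    by_cases hj : j = i₀
    · subst hj; rw [hε, Pi.single_eq_same]
    · rw [hε, Pi.single_eq_of_ne hj, Valuation.map_zero]; exact zero_le
  have hν_pos : 0 < ν := by rw [hν, map_div₀, ← hi₀]; exact div_pos hvs hlam_pos
  have hν_lt_lam : ν < vnorm v ℓ := by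
    by_contra hle
    have : vnorm v ℓ * vnorm v ℓ ≤ ν * vnorm v ℓ := mul_le_mul' (not_lt.1 hle) le_rfl
    rw [hνlam, ← sq] at this
    exact absurd hslt (not_lt.2 this)
  have hν_le : ν ≤ 1 := (hν_lt_lam.le).trans hlam_le
  have hν2 : ν ^ 2 < v s := by
    calc ν ^ 2 = ν * ν := sq ν
      _ < ν * vnorm v ℓ := (mul_lt_mul_iff_of_pos_left hν_pos).2 hν_lt_lam
      _ = v s := hνlam
  have hsum : ∑ j, aeval r (pderiv j G) * ε j = s := by
    rw [Finset.sum_eq_single i₀ (fun j _ hj => by rw [hε, Pi.single_eq_of_ne hj, mul_zero])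
      (fun h => absurd (mem_univ i₀) h), hε, Pi.single_eq_same]
    exact mul_div_cancel₀ _ hℓi₀
  obtain ⟨hT, -, -⟩ := taylor_val_bound v G hrint hεv hν_le
  rw [hsum] at hT
  set b := arc (r + ε) with hb
  have hx : (b - arc r) 0 = s + (aeval (r + ε) G - aeval r G - s) := by
    rw [hb, arc_sub_arc_zero]; ring
  have hvx : v ((b - arc r) 0) = v s := by
    rw [hx]; exact v.map_add_eq_of_lt_left (hT.trans_lt hν2)
  have hq : ∀ j : Fin 4, v ((b - arc r) j.succ) ≤ ν ^ 2 := by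
    intro j
    rw [hb, arc_sub_arc_succ, Pi.add_apply, add_sub_cancel_left, map_pow]
    exact pow_le_pow_left₀ zero_le (hεv j) 2
  have hdom : IsDominant v 0 (b - arc r) := by
    intro j hj
    obtain ⟨j', rfl⟩ := Fin.exists_succ_eq.2 hj
    rw [hvx]
    exact (hq j').trans_lt hν2
  refine ⟨b, ⟨eval_fW_arc (r + ε), ?_⟩, by rw [hdom.vnorm_eq, hvx], hdom⟩
  rw [hb, arc_mem_ball_zero_iff v]
  intro j
  rw [Pi.add_apply]
  exact lt_of_le_of_lt (v.map_add _ _) (max_lt (hrlt j) ((hεv j).trans_lt (hν_lt_lam.trans_le hlam_le)))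

/-- Singular arcs based at `0` violate `𝒫` (as `not_propP_of_singular`, base `0`). [folklore] -/
private theorem not_propP_of_singular_zero [PerfectRing K 2] (hK : ∃ t : K, 0 < v t ∧ v t < 1) {r : Fin 4 → K}
    (hr : arc r ∈ ball v (0 : Fin 5 → K) 1) (hsing : ∀ i, aeval r (pderiv i G) = 0) :
    ¬ PropP v ({a | eval a (fW : MvPolynomial (Fin 5) K) = 0} ∩ ball v 0 1) (arc r) := by
  rintro ⟨s₀, hs₀, H⟩
  obtain ⟨t, ht0, ht1⟩ := hK
  have ht : t ≠ 0 := (Valuation.ne_zero_iff v).1 ht0.ne'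
  have hvs₀ : 0 < v s₀ := lt_of_le_of_ne zero_le ((Valuation.ne_zero_iff v).2 hs₀).symm
  obtain ⟨b, ⟨hbX, hbB⟩, -, hdom⟩ := H (s₀ * t) (mul_ne_zero hs₀ ht)
    (by rw [map_mul]; exact mul_lt_of_lt_one_right hvs₀ ht1)
  obtain ⟨r', rfl⟩ := exists_arc_eq hbX
  exact not_xdom_of_singular_base v (integral_of_arc_mem_ball_zero v hr) (integral_of_arc_mem_ball_zero v hbB)
    hsing hdom

/-- The cancellation lemma at base `0` (as `cancel_of_rvEq`). [folklore] -/
private theorem cancel_of_rvEq_zero [PerfectRing K 2] {r : Fin 4 → K} (hr : arc r ∈ ball v (0 : Fin 5 → K) 1)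
    {σ : K} (hσ : σ ≠ 0) (hσlam : v σ < vnorm v (fun i => aeval r (pderiv i G)))
    {w : Fin 5 → K} (hw : vnorm v w = 1) (hw0 : ¬ IsDominant v 0 w)
    {b : Fin 5 → K} (hbX : eval b (fW : MvPolynomial (Fin 5) K) = 0) (hbB : b ∈ ball v (0 : Fin 5 → K) 1)
    (hrv : RvEq v (b - arc r) (σ ^ 2 • w)) :
    ∃ ρ : Fin 4 → K, (∀ j, v (ρ j) ≤ 1) ∧ (∀ j : Fin 4, v (ρ j ^ 2 - w j.succ) < 1) ∧
      v (∑ j, aeval r (pderiv j G) * ρ j) < vnorm v (fun i => aeval r (pderiv i G)) := by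
  haveI : Fact (Nat.Prime 2) := ⟨Nat.prime_two⟩
  set ℓ : Fin 4 → K := fun j => aeval r (pderiv j G) with hℓ
  have hvσ : 0 < v σ := lt_of_le_of_ne zero_le ((Valuation.ne_zero_iff v).2 hσ).symm
  have hlam_pos : 0 < vnorm v ℓ := lt_trans hvσ hσlam
  obtain ⟨r', rfl⟩ := exists_arc_eq hbX
  have hrint := integral_of_arc_mem_ball_zero v hr
  have hr'int := integral_of_arc_mem_ball_zero v hbB
  set ε : Fin 4 → K := r' - r with hε
  have hr' : r' = r + ε := by rw [hε]; abel
  set m := vnorm v ε with hm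
  have hεv : ∀ j, v (ε j) ≤ m := le_vnorm v ε
  have hm1 : m ≤ 1 := (vnorm_le_iff v).2 fun j => by
    rw [hε, Pi.sub_apply]; exact (v.map_sub _ _).trans (max_le (hr'int j) (hrint j))
  set D := ∑ j, ℓ j * ε j with hD
  obtain ⟨hT, -, -⟩ := taylor_val_bound v G hrint hεv hm1
  rw [← hr'] at hT
  change v (aeval r' G - aeval r G - D) ≤ m ^ 2 at hT
  have hDle : v D ≤ vnorm v ℓ * m := by
    refine v.map_sum_le fun j _ => ?_
    rw [map_mul]; exact mul_le_mul' (le_vnorm v ℓ j) (hεv j)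
  have hvn : vnorm v (arc r' - arc r) = v σ ^ 2 := by
    rw [← hrv.vnorm_eq, vnorm_smul, hw, mul_one, map_pow]
  have hq : ∀ j : Fin 4, v ((arc r' - arc r) j.succ) = v (ε j) ^ 2 := fun j => by
    rw [arc_sub_arc_succ, map_pow, hε, Pi.sub_apply]
  have hndom : ¬ IsDominant v 0 (arc r' - arc r) := fun h =>
    hw0 ((IsDominant.smul_iff (by rw [map_pow]; exact pow_ne_zero 2 hvσ.ne')).1 (h.of_rvEq hrv))
  have hx_le : v ((arc r' - arc r) 0) ≤ m ^ 2 := by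
    by_contra hlt
    apply hndom
    intro j hj
    obtain ⟨j', rfl⟩ := Fin.exists_succ_eq.2 hj
    rw [hq]
    exact lt_of_le_of_lt (pow_le_pow_left₀ zero_le (hεv j') 2) (not_le.1 hlt)
  have hm_eq : m = v σ := by
    apply eq_of_sq_eq_sq
    rw [← hvn]
    refine le_antisymm ?_ ((vnorm_le_iff v).2 fun j => ?_)
    · obtain ⟨j₀, hj₀⟩ := exists_vnorm_eq v ε
      rw [hm, hj₀, ← hq]; exact le_vnorm v _ _
    · refine Fin.cases ?_ (fun j' => ?_) j
      · exact hx_le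
      · rw [hq]; exact pow_le_pow_left₀ zero_le (hεv j') 2
  have hm_pos : 0 < m := by rw [hm_eq]; exact hvσ
  have hm_lt : m < vnorm v ℓ := by rw [hm_eq]; exact hσlam
  have hm2_lt : m ^ 2 < vnorm v ℓ * m := by
    rw [sq]; exact (mul_lt_mul_iff_of_pos_right hm_pos).2 hm_lt
  have hDlt : v D < vnorm v ℓ * m := by
    by_contra hge
    have hDeq : v D = vnorm v ℓ * m := le_antisymm hDle (not_lt.1 hge)
    apply hndom
    intro j hj
    obtain ⟨j', rfl⟩ := Fin.exists_succ_eq.2 hj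
    have hx : (arc r' - arc r) 0 = D + (aeval r' G - aeval r G - D) := by rw [arc_sub_arc_zero]; ring
    rw [hx, v.map_add_eq_of_lt_left (by rw [hDeq]; exact hT.trans_lt hm2_lt), hDeq, hq]
    exact lt_of_le_of_lt (pow_le_pow_left₀ zero_le (hεv j') 2) hm2_lt
  have hcong : ∀ j : Fin 4, v (ε j ^ 2 - σ ^ 2 * w j.succ) < m ^ 2 := by
    intro j
    have hcoord : (arc r' - arc r) j.succ - (σ ^ 2 • w) j.succ = ε j ^ 2 - σ ^ 2 * w j.succ := by
      rw [arc_sub_arc_succ, Pi.smul_apply, smul_eq_mul, hε, Pi.sub_apply]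
    rcases hrv with heq | hlt
    · have : ε j ^ 2 - σ ^ 2 * w j.succ = 0 := by rw [← hcoord, heq, sub_self]
      rw [this, Valuation.map_zero]; exact pow_pos hm_pos 2
    · rw [hvn, ← hm_eq] at hlt
      rw [← hcoord, ← Pi.sub_apply]
      exact lt_of_le_of_lt (le_vnorm v _ _) hlt
  refine ⟨fun j => ε j / σ, fun j => ?_, fun j => ?_, ?_⟩
  · rw [map_div₀, div_le_one₀ hvσ, ← hm_eq]; exact hεv j
  · have : (ε j / σ) ^ 2 - w j.succ = (ε j ^ 2 - σ ^ 2 * w j.succ) / σ ^ 2 := by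
      field_simp
    rw [this, map_div₀, map_pow, ← hm_eq, div_lt_one₀ (pow_pos hm_pos 2)]
    exact hcong j
  · have : ∑ j, ℓ j * (ε j / σ) = D / σ := by rw [hD, Finset.sum_div]; exact Finset.sum_congr rfl fun j _ => by ring
    rw [this, map_div₀, ← hm_eq, div_lt_iff₀ hm_pos]
    exact hDlt

/-- The three non-singular test arcs based at the ORIGIN: `r = (t,0,0,0)` (`G = t¹¹`, `∂G = (t¹⁰,0,0,0)`), `r = (0,0,0,t)`
(`G = 0`, `∂G = (0,0,t⁶,0)`), `r = (0,0,t,t²)` (`G = t¹³`, `∂G = (0,t⁹,t¹²,0)`). [folklore] -/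
private theorem testArcs_origin (t : K) :
    (aeval (![t, 0, 0, 0] : Fin 4 → K) G = t ^ 11 ∧
      aeval (![t, 0, 0, 0] : Fin 4 → K) (pderiv 0 G) = t ^ 10 ∧ aeval (![t, 0, 0, 0] : Fin 4 → K) (pderiv 1 G) = 0 ∧
      aeval (![t, 0, 0, 0] : Fin 4 → K) (pderiv 2 G) = 0 ∧ aeval (![t, 0, 0, 0] : Fin 4 → K) (pderiv 3 G) = 0) ∧
    (aeval (![0, 0, 0, t] : Fin 4 → K) G = 0 ∧
      aeval (![0, 0, 0, t] : Fin 4 → K) (pderiv 0 G) = 0 ∧ aeval (![0, 0, 0, t] : Fin 4 → K) (pderiv 1 G) = 0 ∧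
      aeval (![0, 0, 0, t] : Fin 4 → K) (pderiv 2 G) = t ^ 6 ∧ aeval (![0, 0, 0, t] : Fin 4 → K) (pderiv 3 G) = 0) ∧
    (aeval (![0, 0, t, t ^ 2] : Fin 4 → K) G = t ^ 13 ∧
      aeval (![0, 0, t, t ^ 2] : Fin 4 → K) (pderiv 0 G) = 0 ∧ aeval (![0, 0, t, t ^ 2] : Fin 4 → K) (pderiv 1 G) = t ^ 9 ∧
      aeval (![0, 0, t, t ^ 2] : Fin 4 → K) (pderiv 2 G) = t ^ 12 ∧ aeval (![0, 0, t, t ^ 2] : Fin 4 → K) (pderiv 3 G) = 0) := by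
  obtain ⟨a0, a1, a2, a3⟩ := aeval_pderiv_G (K := K) ![t, 0, 0, 0]
  obtain ⟨b0, b1, b2, b3⟩ := aeval_pderiv_G (K := K) ![0, 0, 0, t]
  obtain ⟨c0, c1, c2, c3⟩ := aeval_pderiv_G (K := K) ![0, 0, t, t ^ 2]
  refine ⟨⟨by simp [aeval_G], by rw [a0]; simp, by rw [a1]; simp, by rw [a2]; simp, a3⟩,
    ⟨by simp [aeval_G], by rw [b0]; simp, by rw [b1]; simp, by rw [b2]; simp, b3⟩,
    ⟨by simp [aeval_G]; ring, by rw [c0]; simp, by rw [c1]; simp; ring, by rw [c2]; simp; ring, c3⟩⟩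

/-- **The core contradiction at the origin** (see the §6 header). [folklore] -/
private theorem core_origin [PerfectRing K 2] (hK : ∃ t : K, 0 < v t ∧ v t < 1) {w : Fin 5 → K} (hw : vnorm v w = 1)
    {φ : (Fin 5 → K) → (Fin 5 → K)} {C : Set (Fin 5 → K)}
    (hφ : IsRisometry v ({a | eval a (fW : MvPolynomial (Fin 5) K) = 0} ∩ ball v 0 1) C φ)
    (hT : ∀ c ∈ C, ∀ s : K, v s < 1 → c + s • w ∈ C) : False := by
  haveI : Fact (Nat.Prime 2) := ⟨Nat.prime_two⟩
  obtain ⟨t, ht0, ht1⟩ := hK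
  have ht : t ≠ 0 := (Valuation.ne_zero_iff v).1 ht0.ne'
  set A0 : Set (Fin 5 → K) := {a | eval a (fW : MvPolynomial (Fin 5) K) = 0} ∩ ball v 0 1 with hA0
  have stepA : ∀ a ∈ A0, ∀ s : K, v s < 1 → ∃ b ∈ A0, φ b = φ a + s • w ∧ RvEq v (b - a) (s • w) := by
    intro a ha s hs
    have hmem : φ a + s • w ∈ C := hT _ (hφ.bijOn.mapsTo ha) s hs
    rw [← hφ.image_eq] at hmem
    obtain ⟨b, hb, hbeq⟩ := hmem
    refine ⟨b, hb, hbeq, ?_⟩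
    have := hφ.rvEq hb ha
    rw [hbeq, add_sub_cancel_left] at this
    exact this.symm
  have memA0 : ∀ r : Fin 4 → K, (∀ i, v (r i) < 1) → arc r ∈ A0 := fun r h =>
    ⟨eval_fW_arc r, (arc_mem_ball_zero_iff v r).2 h⟩
  -- the origin arc
  have hO : arc (0 : Fin 4 → K) ∈ A0 := memA0 0 fun i => by simp
  have hOeq : arc (0 : Fin 4 → K) = 0 := by
    funext j
    refine Fin.cases ?_ (fun i => ?_) j
    · rw [arc_zero, aeval_G]; simp
    · rw [arc_succ]; simp
  have hOsing : ∀ i, aeval (0 : Fin 4 → K) (pderiv i G) = 0 := by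
    obtain ⟨e0, e1, e2, e3⟩ := aeval_pderiv_G (K := K) 0
    intro i; fin_cases i
    · rw [show ((⟨0, by norm_num⟩ : Fin 4)) = 0 from rfl, e0]; simp
    · rw [show ((⟨1, by norm_num⟩ : Fin 4)) = 1 from rfl, e1]; simp
    · rw [show ((⟨2, by norm_num⟩ : Fin 4)) = 2 from rfl, e2]; simp
    · rw [show ((⟨3, by norm_num⟩ : Fin 4)) = 3 from rfl, e3]
  have hnotO : ¬ PropP v A0 (arc 0) := not_propP_of_singular_zero v ⟨t, ht0, ht1⟩ hO.2 hOsing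
  obtain ⟨b₁, hb₁, hφb₁, hrv₁⟩ := stepA _ hO t ht1
  have hnotb₁ : ¬ PropP v A0 b₁ := by
    intro hb
    apply hnotO
    have h1 : PropP v C (φ b₁) := (PropP.iff_map v hφ hb₁).1 hb
    rw [hφb₁] at h1
    have h2 := PropP.add_const v (-(t • w)) h1
    rw [add_neg_cancel_right] at h2
    have h3 : PropP v C (φ (arc 0)) := by
      refine h2.mono v ?_
      rintro _ ⟨c, hc, rfl⟩
      have := hT c hc (-t) (by rw [Valuation.map_neg]; exact ht1)
      rwa [neg_smul] at this
    exact (PropP.iff_map v hφ hO).2 h3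
  obtain ⟨r₁, rfl⟩ := exists_arc_eq hb₁.1
  have hsing₁ : ∀ i, aeval r₁ (pderiv i G) = 0 := by
    by_contra h
    simp only [not_forall] at h
    obtain ⟨i, hi⟩ := h
    exact hnotb₁ (propP_of_nonsingular_zero v hb₁.2 hi)
  have hr₁lt := (arc_mem_ball_zero_iff v r₁).1 hb₁.2
  have hr₁ne : r₁ ≠ 0 := by
    intro h
    have hzero : arc r₁ - arc 0 = 0 := by rw [h, sub_self]
    have : t • w = 0 := (hrv₁.eq_zero_iff).1 hzero
    have hn : vnorm v (t • w) = v t := by rw [vnorm_smul, hw, mul_one]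
    rw [this, vnorm_zero] at hn
    exact ht0.ne' hn.symm
  rw [hOeq, sub_zero] at hrv₁
  -- (α) w is not x-dominant
  have hw0 : ¬ IsDominant v 0 w := by
    intro h
    have h' : IsDominant v 0 (t • w) := (IsDominant.smul_iff ((Valuation.ne_zero_iff v).2 ht)).2 h
    have h'' : IsDominant v 0 (arc r₁ - arc 0) := by rw [hOeq, sub_zero]; exact h'.of_rvEq hrv₁.symm
    exact not_xdom_of_singular_base v (fun i => by simp) (fun i => (hr₁lt i).le) hOsing h''
  -- (β) v(w₄) < 1
  have hw4 : v (w 4) < 1 := by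
    by_contra hge
    have hw4eq : v (w 4) = vnorm v w := le_antisymm (le_vnorm v w 4) (by rw [hw]; exact not_lt.1 hge)
    have hsw : v ((t • w) 4) = vnorm v (t • w) := by rw [Pi.smul_apply, smul_eq_mul, map_mul, vnorm_smul, hw4eq]
    have hb4 : v (arc r₁ 4) = vnorm v (arc r₁) := attains_of_rvEq v hrv₁.symm hsw
    have hmax : ∀ i, v (r₁ i) ≤ v (r₁ 3) := by
      intro i
      have h1 : v (arc r₁ i.succ) ≤ vnorm v (arc r₁) := le_vnorm v _ _
      rw [← hb4, show (4 : Fin 5) = (3 : Fin 4).succ from rfl, arc_succ, arc_succ, map_pow, map_pow] at h1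
      exact le_of_pow_le_pow_left₀ two_ne_zero zero_le h1
    obtain ⟨-, -, e2, -⟩ := aeval_pderiv_G r₁
    exact hr₁ne (eq_zero_of_singular_vmax v hr₁lt hmax (by rw [← e2]; exact hsing₁ 2))
  -- (γ) the three test arcs, levels σ
  obtain ⟨⟨gY, dY0, dY1, dY2, dY3⟩, ⟨gV, dV0, dV1, dV2, dV3⟩, ⟨gZ, dZ0, dZ1, dZ2, dZ3⟩⟩ := testArcs_origin (K := K) t
  have hpow_lt : ∀ {a b : ℕ}, b < a → v t ^ a < v t ^ b := fun h => pow_lt_pow_right_of_lt_one₀ ht0 ht1 h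
  have hpow_lt1 : ∀ {a : ℕ}, a ≠ 0 → v (t ^ a) < 1 := fun h => by rw [map_pow]; exact pow_lt_one₀ zero_le ht1 h
  -- arc (t,0,0,0): kills w_y
  have hYmem : arc (![t, 0, 0, 0] : Fin 4 → K) ∈ A0 := memA0 _ fun i => by fin_cases i <;> simp [ht1]
  have hYnorm : vnorm v (fun i => aeval (![t, 0, 0, 0] : Fin 4 → K) (pderiv i G)) = v t ^ 10 := by
    refine le_antisymm ((vnorm_le_iff v).2 fun j => ?_) ?_
    · fin_cases j <;> simp [dY0, dY1, dY2, dY3]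
    · have := le_vnorm v (fun i => aeval (![t, 0, 0, 0] : Fin 4 → K) (pderiv i G)) 0
      simpa [dY0] using this
  obtain ⟨bY, hbY, -, hrvY⟩ := stepA _ hYmem ((t ^ 11) ^ 2) (by rw [← pow_mul]; exact hpow_lt1 (by norm_num))
  obtain ⟨ρY, hρY1, hρY2, hρY3⟩ := cancel_of_rvEq_zero v hYmem.2 (pow_ne_zero 11 ht)
    (by rw [hYnorm, map_pow]; exact hpow_lt (by norm_num)) hw hw0 hbY.1 hbY.2 hrvY
  have hwy : v (w 1) < 1 := by
    rw [hYnorm, Fin.sum_univ_four, dY0, dY1, dY2, dY3] at hρY3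
    simp only [zero_mul, add_zero, map_mul, map_pow] at hρY3
    have hρ : v (ρY 0) < 1 := by
      by_contra h
      exact absurd hρY3 (not_lt.2 (le_mul_of_one_le_right' (not_lt.1 h)))
    have e : w 1 = ρY 0 ^ 2 - (ρY 0 ^ 2 - w (0 : Fin 4).succ) := by simp
    rw [e]
    exact lt_of_le_of_lt (v.map_sub _ _)
      (max_lt (by rw [map_pow]; exact pow_lt_one₀ zero_le hρ two_ne_zero) (hρY2 0))
  -- arc (0,0,0,t): kills w_w
  have hVmem : arc (![0, 0, 0, t] : Fin 4 → K) ∈ A0 := memA0 _ fun i => by fin_cases i <;> simp [ht1]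
  have hVnorm : vnorm v (fun i => aeval (![0, 0, 0, t] : Fin 4 → K) (pderiv i G)) = v t ^ 6 := by
    refine le_antisymm ((vnorm_le_iff v).2 fun j => ?_) ?_
    · fin_cases j <;> simp [dV0, dV1, dV2, dV3]
    · have := le_vnorm v (fun i => aeval (![0, 0, 0, t] : Fin 4 → K) (pderiv i G)) 2
      simpa [dV2] using this
  obtain ⟨bV, hbV, -, hrvV⟩ := stepA _ hVmem ((t ^ 7) ^ 2) (by rw [← pow_mul]; exact hpow_lt1 (by norm_num))
  obtain ⟨ρV, hρV1, hρV2, hρV3⟩ := cancel_of_rvEq_zero v hVmem.2 (pow_ne_zero 7 ht)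
    (by rw [hVnorm, map_pow]; exact hpow_lt (by norm_num)) hw hw0 hbV.1 hbV.2 hrvV
  have hww : v (w 3) < 1 := by
    rw [hVnorm, Fin.sum_univ_four, dV0, dV1, dV2, dV3] at hρV3
    simp only [zero_mul, add_zero, zero_add, map_mul, map_pow] at hρV3
    have hρ : v (ρV 2) < 1 := by
      by_contra h
      exact absurd hρV3 (not_lt.2 (le_mul_of_one_le_right' (not_lt.1 h)))
    have e : w 3 = ρV 2 ^ 2 - (ρV 2 ^ 2 - w (2 : Fin 4).succ) := by simp
    rw [e]
    exact lt_of_le_of_lt (v.map_sub _ _)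
      (max_lt (by rw [map_pow]; exact pow_lt_one₀ zero_le hρ two_ne_zero) (hρV2 2))
  -- arc (0,0,t,t²): kills w_z
  have hZmem : arc (![0, 0, t, t ^ 2] : Fin 4 → K) ∈ A0 := by
    refine memA0 _ fun i => ?_
    fin_cases i
    · simp
    · simp
    · simpa using ht1
    · simpa using hpow_lt1 (a := 2) two_ne_zero
  have hZnorm : vnorm v (fun i => aeval (![0, 0, t, t ^ 2] : Fin 4 → K) (pderiv i G)) = v t ^ 9 := by
    refine le_antisymm ((vnorm_le_iff v).2 fun j => ?_) ?_
    · fin_cases j <;> simp [dZ0, dZ1, dZ2, dZ3]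
      exact pow_le_pow_right_of_le_one' ht1.le (by norm_num)
    · have := le_vnorm v (fun i => aeval (![0, 0, t, t ^ 2] : Fin 4 → K) (pderiv i G)) 1
      simpa [dZ1] using this
  obtain ⟨bZ, hbZ, -, hrvZ⟩ := stepA _ hZmem ((t ^ 10) ^ 2) (by rw [← pow_mul]; exact hpow_lt1 (by norm_num))
  obtain ⟨ρZ, hρZ1, hρZ2, hρZ3⟩ := cancel_of_rvEq_zero v hZmem.2 (pow_ne_zero 10 ht)
    (by rw [hZnorm, map_pow]; exact hpow_lt (by norm_num)) hw hw0 hbZ.1 hbZ.2 hrvZ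
  have hwz : v (w 2) < 1 := by
    rw [hZnorm, Fin.sum_univ_four, dZ0, dZ1, dZ2, dZ3] at hρZ3
    simp only [zero_mul, add_zero, zero_add] at hρZ3
    have e : t ^ 9 * ρZ 1 + t ^ 12 * ρZ 2 = t ^ 9 * (ρZ 1 + t ^ 3 * ρZ 2) := by ring
    rw [e, map_mul, map_pow] at hρZ3
    have h' : v (ρZ 1 + t ^ 3 * ρZ 2) < 1 := by
      by_contra h
      exact absurd hρZ3 (not_lt.2 (le_mul_of_one_le_right' (not_lt.1 h)))
    have hρ : v (ρZ 1) < 1 := by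
      have e2 : ρZ 1 = (ρZ 1 + t ^ 3 * ρZ 2) - t ^ 3 * ρZ 2 := by ring
      rw [e2]
      refine lt_of_le_of_lt (v.map_sub _ _) (max_lt h' ?_)
      rw [map_mul, map_pow]
      calc v t ^ 3 * v (ρZ 2) ≤ v t ^ 3 * 1 := mul_le_mul' le_rfl (hρZ1 2)
        _ < 1 := by rw [mul_one]; exact pow_lt_one₀ zero_le ht1 (by norm_num)
    have e3 : w 2 = ρZ 1 ^ 2 - (ρZ 1 ^ 2 - w (1 : Fin 4).succ) := by simp
    rw [e3]
    exact lt_of_le_of_lt (v.map_sub _ _)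
      (max_lt (by rw [map_pow]; exact pow_lt_one₀ zero_le hρ two_ne_zero) (hρZ2 1))
  -- contradiction: the x-coordinate must carry the size, making w x-dominant
  apply hw0
  have hwx : v (w 0) = 1 := by
    obtain ⟨i, hi⟩ := exists_vnorm_eq v w
    rw [hw] at hi
    fin_cases i
    · exact hi.symm
    · exact absurd hi.symm hwy.ne
    · exact absurd hi.symm hwz.ne
    · exact absurd hi.symm hww.ne
    · exact absurd hi.symm hw4.ne
  intro j hj
  rw [hwx]
  fin_cases j
  · exact absurd rfl hj
  · exact hwy
  · exact hwz
  · exact hww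
  · exact hw4

end OriginCharTwo

section OriginMain

variable [CharP K 2] [PerfectRing K 2]

/-- **No primitive direction is a riso-triviality direction of `B_{X₂,0}` (translation form).** As
`wq_no_translation_invariant_straightening`, at the ORIGIN. (derived here) [cite: Monreal2026, Def. 3.14, Def. 3.15 and Def. 3.17] -/
theorem wq_no_translation_invariant_straightening_origin (hK : ∃ t : K, 0 < v t ∧ v t < 1) {w : Fin 5 → K}
    (hw : vnorm v w = 1) {φ : (Fin 5 → K) → (Fin 5 → K)} {C : Set (Fin 5 → K)}
    (hφ : IsRisometry v ({a | eval a (fW : MvPolynomial (Fin 5) K) = 0} ∩ ball v 0 1) C φ)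
    (hT : ∀ c ∈ C, ∀ s : K, v s < 1 → c + s • w ∈ C) : False :=
  core_origin v hK hw hφ hT

/-- **`X₂(K) ∩ B_0` is `W`-riso-trivial on `B_0` for NO non-zero `κ`-subspace `W`** (Def. 3.17), at the origin of the W-Q
fourfold, for every perfect field of characteristic `2`, every non-trivial valuation and every coefficient field. (derived here)
[cite: Monreal2026, Def. 3.17] -/
theorem wq_not_isRisoTrivialOn_origin (hK : ∃ t : K, 0 < v t ∧ v t < 1) (κ : Type*) [Field κ] [Algebra κ K]
    {W : Submodule κ (Fin 5 → κ)} (hW : W ≠ ⊥) :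
    ¬ IsRisoTrivialOn v κ {a : Fin 5 → K | eval a (fW : MvPolynomial (Fin 5) K) = 0} 0 1 W := by
  rintro ⟨φ, C, hC, hφ, hTI⟩
  obtain ⟨wb, hwbW, hwb0⟩ := Submodule.exists_mem_ne_zero_of_ne_bot hW
  set w₁ : Fin 5 → K := fun i => algebraMap κ K (wb i) with hw₁
  have hw₁0 : 0 < vnorm v w₁ := by
    obtain ⟨i, hi⟩ : ∃ i, wb i ≠ 0 := by
      by_contra h
      simp only [not_exists, not_not] at h
      exact hwb0 (funext h)
    have : 0 < v (w₁ i) := by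
      refine lt_of_le_of_ne zero_le (Ne.symm ((Valuation.ne_zero_iff v).2 ?_))
      rw [hw₁]; exact (map_ne_zero (algebraMap κ K)).2 hi
    exact lt_of_lt_of_le this (le_vnorm v w₁ i)
  obtain ⟨i₀, hi₀⟩ := exists_vnorm_eq v w₁
  set c : K := w₁ i₀ with hc
  have hc0 : c ≠ 0 := (Valuation.ne_zero_iff v).1 (by rw [← hi₀]; exact hw₁0.ne')
  set w : Fin 5 → K := c⁻¹ • w₁ with hwdef
  have hw : vnorm v w = 1 := by
    rw [hwdef, vnorm_smul, map_inv₀, ← hi₀, inv_mul_cancel₀ hw₁0.ne']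
  refine core_origin v hK hw hφ fun c' hc' s hs => ?_
  have hsw : s • w = (s * c⁻¹) • w₁ := by rw [hwdef, smul_smul]
  have hmem : (s * c⁻¹) • w₁ ∈ subspaceBall v κ W 1 := by
    refine smul_mem_subspaceBall hwbW (s * c⁻¹) ?_
    rw [← hsw, vnorm_smul, hw, mul_one]; exact hs
  have := hTI.add_mem ⟨hc', hC hc'⟩ hmem
  rw [← hsw] at this
  exact this.1

/-- **`rtd_{B_0}(X₂(K)) = 0`** (Def. 3.17) at the ORIGIN of the W-Q fourfold: the second rtd-value of the barrier
`RisoBlindAlongInseparableOrbit`, now kernel-checked (the report's §9.3 conclusion, by a classification-free route).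
(derived here) [cite: Monreal2026, Def. 3.17 and Def. 4.7] -/
theorem wq_rtd_origin_eq_zero (hK : ∃ t : K, 0 < v t ∧ v t < 1) (κ : Type*) [Field κ] [Algebra κ K] :
    rtd v κ {a : Fin 5 → K | eval a (fW : MvPolynomial (Fin 5) K) = 0} 0 1 = 0 :=
  rtd_eq_zero_of fun _ hW => wq_not_isRisoTrivialOn_origin v hK κ hW

omit [PerfectRing K 2] in
/-- The origin lies on `X₂(K)` and in its own ball, so `rtd = 0` at `0` is the genuine value of Def. 3.17. (derived here)
[cite: Monreal2026, Def. 3.17] -/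
theorem wq_origin_mem : (0 : Fin 5 → K) ∈
    {a : Fin 5 → K | eval a (fW : MvPolynomial (Fin 5) K) = 0} ∩ ball v 0 1 := by
  have hOeq : arc (0 : Fin 4 → K) = 0 := by
    funext j
    refine Fin.cases ?_ (fun i => ?_) j
    · rw [arc_zero, aeval_G]; simp
    · rw [arc_succ]; simp
  have h : arc (0 : Fin 4 → K) ∈ {a : Fin 5 → K | eval a (fW : MvPolynomial (Fin 5) K) = 0} ∩ ball v 0 1 :=
    ⟨eval_fW_arc _, (arc_mem_ball_zero_iff v _).2 fun i => by simp⟩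
  rwa [hOeq] at h

end OriginMain

end RisoBlind

open RisoBlind Literature.AlgebraicGeometry.Resolution.Riso Literature.AlgebraicGeometry.Hironaka2017.WQWitness in
/-- **Barrier «RisoBlindAlongInseparableOrbit» — kernel upgrade of BOTH rtd-values (v2).** For EVERY perfect field `K` of
characteristic `2`, EVERY non-trivial valuation `v` on `K` and EVERY coefficient field `κ → K`, on the W-Q fourfold
`X₂ = V(fW) ⊂ 𝔸⁵`: the riso-triviality dimensions (Monreal Def. 3.17, `Riso.rtd`) of the arc balls at the ORIGIN `0`
(`Inv`-maximal point in the cell's account) and at the orbit point `P = (0,0,1,1,0) ∈ Γ₂` are BOTH `0`, and at neither point is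
any non-zero `κ`-subspace a riso-triviality direction. Hence the first-shadow datum `rtd` takes the same value `0` at `0` and at
`P`: it does NOT separate the pair — the content of the cell's verdict «K3.2′ (V-a) riso/rtd: DEAD on W2» (director-resolution
2026-08-27T02:39:05Z), previously resting on the hand lemmas of `KILL-TEST-K3.2prime.md` §9, is now kernel-checked in full
generality (no Hahn series, no algebraic closure). Scope-caveat (b) of `Monreal2026_risoBlindAlongInseparableOrbit` is thereby
closed for both points; what remains hand/kit in that entry are only the cell's `Inv`-values (the manuscript's invariant AS TYPED,
a candidate under adjudication) and the claim «rtd ≡ 0 along Γ₂∖0» at points other than `P` (torus translates of `P`; not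
re-derived here). HONEST FRAMING: theorems about Monreal's DEFINITIONS for one arc set in `𝔸⁵`, applied to the cell's own specimen;
nothing here bears on the characteristic-0 theory, on Question 1.6 in general, on resolution of singularities in characteristic
`p`, or on H. Hironaka's 2017 manuscript (under adjudication, D-0012). Second reading of report §9.3: READ-AGREE on the conclusion
`rtd_0 = 0`, by a different (classification-free) argument. (derived here) [cite: Monreal2026, Def. 3.14, Def. 3.15, Def. 3.17 and Def. 4.7] -/
theorem Monreal2026_risoBlindAlongInseparableOrbit_rtdBoth :
    ∀ (K : Type*) [Field K] [CharP K 2] [PerfectRing K 2] (Γ₀ : Type*) [LinearOrderedCommGroupWithZero Γ₀]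
      (v : Valuation K Γ₀), (∃ t : K, 0 < v t ∧ v t < 1) →
      ∀ (κ : Type*) [Field κ] [Algebra κ K],
        ((0 : Fin 5 → K) ∈ {a : Fin 5 → K | MvPolynomial.eval a (fW : MvPolynomial (Fin 5) K) = 0} ∩ ball v 0 1 ∧
          (∀ W : Submodule κ (Fin 5 → κ), W ≠ ⊥ →
            ¬ IsRisoTrivialOn v κ {a : Fin 5 → K | MvPolynomial.eval a (fW : MvPolynomial (Fin 5) K) = 0} 0 1 W) ∧
          rtd v κ {a : Fin 5 → K | MvPolynomial.eval a (fW : MvPolynomial (Fin 5) K) = 0} 0 1 = 0) ∧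
        ((![0, 0, 1, 1, 0] : Fin 5 → K) ∈ {a : Fin 5 → K | MvPolynomial.eval a (fW : MvPolynomial (Fin 5) K) = 0} ∩
            ball v ![0, 0, 1, 1, 0] 1 ∧
          (∀ W : Submodule κ (Fin 5 → κ), W ≠ ⊥ →
            ¬ IsRisoTrivialOn v κ {a : Fin 5 → K | MvPolynomial.eval a (fW : MvPolynomial (Fin 5) K) = 0}
              ![0, 0, 1, 1, 0] 1 W) ∧
          rtd v κ {a : Fin 5 → K | MvPolynomial.eval a (fW : MvPolynomial (Fin 5) K) = 0} ![0, 0, 1, 1, 0] 1 = 0) :=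
  fun _ _ _ _ _ _ v hK κ _ _ =>
    ⟨⟨wq_origin_mem v, fun _ hW => wq_not_isRisoTrivialOn_origin v hK κ hW, wq_rtd_origin_eq_zero v hK κ⟩,
      ⟨wq_P_mem v, fun _ hW => wq_not_isRisoTrivialOn_P v hK κ hW, wq_rtd_P_eq_zero v hK κ⟩⟩

end Literature.Barriers.ResolutionOfSingularities
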